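import Literature.MathematicalPhysics.StatisticalMechanics.FlatleyTheil2015Crystallization
import Literature.Analysis.Calculus.CantorFunction
import Mathlib.MeasureTheory.Integral.IntervalIntegral.FundThmCalculus
import Mathlib.Analysis.Calculus.Deriv.CompMul
import Mathlib.Analysis.Calculus.Deriv.Shift
import Mathlib.Analysis.SpecialFunctions.SmoothTransition
import HarnessLib

/-!
# Flatley–Theil 2015, Theorem 1.1 as transcribed (`FlatleyTheil2015_thm11`) is false

Main result: `FlatleyTheil2015_thm11_false : ¬ FlatleyTheil2015_thm11`.

## What is refuted, and why it is refutable

`FlatleyTheil2015_thm11` (file `FlatleyTheil2015Crystallization`) transcribes Theorem 1.1 of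
[FlatleyTheil2015] over the hypothesis classes `IsLocalizedPair α V` / `IsLocalizedTriple α Ψ`
(file `Literature/Barriers/AtomisticToContinuum/LocalizedPotentialsExcludeLennardJones`), which
read the paper's `V''` in (2.5), (2.7), (2.8) of Definition 2.1 as Lean's `deriv^[2] V`, i.e.
`deriv (deriv V)` with the junk value `0` wherever `V'` is not differentiable, and do not ask `V'`
to be differentiable. The discrepancy record of `FlatleyTheil2015Crystallization` (section
`PrintedClassEmpty`) already notes that this class is strictly larger than the paper's `Y_α`.
This file shows that it is so much larger that the transcribed theorem FAILS: for every
`0 < α ≤ 10⁻¹⁰` it contains a pair `(V, Ψ)` — `TranscribedExample.Vp α`, `TranscribedExample.Psi α`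
— with permutation-invariant three-body term, together with a two-point configuration
`Y = {0, p}`, `|p| = 27/20`, whose energy per particle is `V(27/20) = -1000`, while
`E_fcc(r) ≥ -756` for every dilation `r > 0` (`TranscribedExample.fccEnergy_ge`). This contradicts
clause (i) (`∃ r > 0, E_fcc(r) < E(Y)/#Y`) for every `α₀`.

The loophole: `V' = v` is taken continuous and, off the well `(1-α, 1+α)`, a finite combination
of rescaled Cantor functions (`Literature.Analysis.Calculus.CantorFunction`: continuous, monotone,
`deriv cantorFn = 0` everywhere — `0` a.e. genuinely, junk `0` on the Cantor set). Hence
`deriv (deriv V) = 0` on `[1+α, ∞)` (`TranscribedExample.deriv_v_of_ge`), so (2.7)–(2.8) as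
transcribed hold trivially, while `V ∈ C¹([0,∞))` has an essentially arbitrary shape there.

## The example

`V = Vp α = -1 + ∫₁ v`, `v = v0 + Σᵢ cᵢ · cantorFn((· - pᵢ)·400)` (15 ramps of length
`ℓ = 1/400`, `TranscribedExample.pts/cfs`), giving (`TranscribedExample.Vp_*`):
core `V = 2/α - 1 + (4/α²)(1-α-r)` on `[0, 1-α]`; well `V = -1 + (2/α³)(r-1)²` on `[1-α, 1+α]`
(`V'' = 4/α³` genuinely); a high plateau `Ptop = 6/α - 1 + 1/(200α²)` and a long linear descent
to `0` at `1.2925`; `V = 0` on `[1.2925, 1.335]`; a deep well, `V = -1000` on `[1.3425, 1.3575]`,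
`V ≥ -1000` on `(1.335, 1.365)`; `V = 0` on `[1.365, 1.55] ∋ √2`; a bump `V = 1` on
`[1.5725, 1.68] ∋ √(8/3)` (fcc selection); `V = 0` on `[1.7025, 2.655] ∋ √3, 2, √5, √6, √7`;
a compensating plateau `V = +1000` on `[2.6625, 2.73] ⊃ 2·(1.335, 1.365)`; `V = 0` on
`[2.7375, ∞)`. All fcc distances `√q`, `q ≥ 2` an integer (`|fccPoint a|² = Qh a ∈ ℕ`), are zeros
of `V`, so `E_pair(1) = -#U` (`U` = nearest-neighbour labels) and "no dilation lowers the pair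
energy" (`le_fccLatticeSum`) holds: for `r ≥ 1+α` the doubling map `k ↦ 2k` sends deep-well
labels injectively to plateau labels; for `1-α < r < 1+α` only nearest neighbours can be negative;
for `r ≤ 1-α` the core repulsion `2/α - 1` per core label dominates the at most
`(4(1+α)/r + 1)³` well labels (lattice points counted through the cube `[-n, n]³`,
`aᵢ² ≤ 2|fccPoint a|²`).
`Ψ = Psi α = -∏ Aw(sᵢ) + (1/α)(1 - ∏(1 - Uc(sᵢ)))·∏ Wc(sᵢ)` with `Real.smoothTransition`
plateaus: smooth, symmetric, `Ψ(1,1,1) = -1 ≤ Ψ`, `Ψ ≥ 0` if some `|sᵢ - 1| ≥ α`, `Ψ = 1/α` on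
the core region, `Ψ = 0` if some side is `≥ 7/5` (`isLocalizedTriple_Psi`). The three-body
lattice sum is bounded below using only these class axioms (`Psi_pointwise`): `≥ 0` for
`r ≥ 1+α`, `≥ -#U²` for `1-α < r < 1+α` (`#U ≤ 27` crudely), and `≥ 0` for `r ≤ 1-α` where the
`Ψ`-core triangles (`≥ 1/α` each, at least `N(N-1)` of them from a punctured cube, `N ≍ r⁻³`)
dominate the at most `#near²` possibly negative ones; the constant `α ≤ 10⁻¹⁰` makes the two
crude counts comparable (split at `r = 1/10`).

## Status and scope

This refutes the TRANSCRIBED statement only. The printed Theorem 1.1 (with classical second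
derivatives) is not touched — its hypothesis class is even empty for `α ≤ 1/4` as printed
(`FlatleyTheil2015_thm11_printed`, `not_isLocalizedPair_of_differentiableOn`), so neither Lean
statement is a usable 3-D crystallization theorem; a faithful, non-vacuous transcription of
[FlatleyTheil2015, Thm 1.1 / Definition 2.1] remains to be written (the tree's `IsLocalizedPair`
must at least require `V'` to be differentiable where (2.7)–(2.8) are imposed, and the printed
constants of (2.5)–(2.8) need the authors' intended reading). No Summits file uses
`FlatleyTheil2015_thm11` as a hypothesis (checked 2026-08-25).

References: [cite: FlatleyTheil2015, Thm 1.1 (arXiv 1407.0692 p. 4), Definition 2.1 (pp. 7–8)];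
the Cantor function [cite: Carothers2000, Ch. 2 pp. 33–35 and Example 20.13].
-/

noncomputable section

open Set Filter Topology MeasureTheory intervalIntegral
open Literature.Analysis.Calculus
open Literature.Barriers.AtomisticToContinuum.FlatleyTheil2015

namespace Literature.MathematicalPhysics.StatisticalMechanics.FlatleyTheil2015

namespace TranscribedExample

/-! ### A. Cantor ramps: `cR a s = cantorFn ((s - a) * 400)` and their integrals -/

/-- The ramp length `ℓ = 1/400`. [folklore] -/
private def ℓ : ℝ := 1 / 400

/-- A Cantor ramp of length `ℓ` starting at `a`: `0` up to `a`, `1` from `a + ℓ` on. [folklore] -/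
private def cR (a s : ℝ) : ℝ := cantorFn ((s - a) * 400)

/-- A ramp vanishes to the left of its start point. [folklore] -/
private theorem cR_of_le {a s : ℝ} (h : s ≤ a) : cR a s = 0 :=
  cantorFn_of_nonpos (by nlinarith)

/-- A ramp equals `1` to the right of its end point `a + ℓ`. [folklore] -/
private theorem cR_of_ge {a s : ℝ} (h : a + ℓ ≤ s) : cR a s = 1 :=
  cantorFn_of_one_le (by unfold ℓ at h; nlinarith)

/-- Ramps take values in `[0, 1]`. [folklore] -/
private theorem cR_mem_Icc (a s : ℝ) : cR a s ∈ Icc (0:ℝ) 1 := cantorFn_mem_Icc _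

/-- Ramps are continuous. [folklore] -/
private theorem continuous_cR (a : ℝ) : Continuous (cR a) :=
  continuous_cantorFn.comp ((continuous_id.sub continuous_const).mul continuous_const)

/-- Ramps are monotone. [folklore] -/
private theorem monotone_cR (a : ℝ) : Monotone (cR a) := fun s t hst =>
  monotone_cantorFn (by nlinarith)

/-- `deriv (cR a) = 0` everywhere (Lean's `deriv` of the Cantor function vanishes identically). [folklore] -/
private theorem deriv_cR (a s : ℝ) : deriv (cR a) s = 0 := by
  let g : ℝ → ℝ := fun u => cantorFn (400 * u)
  have h1 : cR a = fun s => g (s - a) := by funext s; simp [cR, g, mul_comm]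
  have h2 : deriv g (s - a) = 0 := by
    show deriv (fun u => cantorFn (400 * u)) (s - a) = 0
    rw [deriv_comp_mul_left 400 cantorFn (s - a), deriv_cantorFn]; simp
  rw [h1, deriv_comp_sub_const, h2]

/-- Locally constant before the ramp. [folklore] -/
private theorem cR_eventuallyEq_zero {a s : ℝ} (h : s < a) : cR a =ᶠ[𝓝 s] fun _ => 0 :=
  Filter.eventuallyEq_of_mem (Iio_mem_nhds h) fun _ ht => cR_of_le (le_of_lt ht)

/-- Locally constant after the ramp. [folklore] -/
private theorem cR_eventuallyEq_one {a s : ℝ} (h : a + ℓ < s) : cR a =ᶠ[𝓝 s] fun _ => 1 :=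
  Filter.eventuallyEq_of_mem (Ioi_mem_nhds h) fun _ ht => cR_of_ge (le_of_lt ht)

/-- A trapezoid for `v`: up-ramp at `a`, down-ramp at `b` (`b ≥ a + ℓ`). [folklore] -/
private def trap (a b s : ℝ) : ℝ := cR a s - cR b s

/-- The difference of two ramps vanishes left of the first ramp. [folklore] -/
private theorem trap_of_le {a b s : ℝ} (h : s ≤ a) (hab : a ≤ b) : trap a b s = 0 := by
  rw [trap, cR_of_le h, cR_of_le (h.trans hab)]; ring

/-- The difference of two ramps vanishes right of the second ramp. [folklore] -/
private theorem trap_of_ge {a b s : ℝ} (h : b + ℓ ≤ s) (hab : a ≤ b) : trap a b s = 0 := by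
  rw [trap, cR_of_ge (by linarith), cR_of_ge h]; ring

/-- The difference of an earlier and a later ramp is non-negative. [folklore] -/
private theorem trap_nonneg {a b : ℝ} (hab : a ≤ b) (s : ℝ) : 0 ≤ trap a b s := by
  unfold trap cR
  have := monotone_cantorFn (show (s - b) * 400 ≤ (s - a) * 400 by nlinarith)
  linarith

/-- The difference of two ramps is at most `1`. [folklore] -/
private theorem trap_le_one (a b s : ℝ) : trap a b s ≤ 1 := by
  unfold trap
  linarith [(cR_mem_Icc a s).2, (cR_mem_Icc b s).1]

/-- Between the two ramps their difference is `1`. [folklore] -/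
private theorem trap_eq_one {a b s : ℝ} (h1 : a + ℓ ≤ s) (h2 : s ≤ b) : trap a b s = 1 := by
  rw [trap, cR_of_ge h1, cR_of_le h2]; ring

/-- `trap` is continuous. [folklore] -/
private theorem continuous_trap (a b : ℝ) : Continuous (trap a b) :=
  (continuous_cR a).sub (continuous_cR b)

/-! ### B. The integrated ramp -/

/-- `∫₀¹ cantorFn` transported: `∫_{a}^{a+ℓ} cR a = ℓ/2`. [folklore] -/
private theorem integral_cR_ramp (a : ℝ) : ∫ x in a..a + ℓ, cR a x = ℓ / 2 := by
  have h : (∫ x in a..a + ℓ, cR a x) = ∫ x in a..a + ℓ, cantorFn (x / ℓ - a / ℓ) := by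
    congr 1; ext x; unfold cR ℓ; congr 1; ring
  rw [h, intervalIntegral.integral_comp_div_sub cantorFn (by norm_num [ℓ] : ℓ ≠ 0)]
  have e1 : a / ℓ - a / ℓ = 0 := sub_self _
  have e2 : (a + ℓ) / ℓ - a / ℓ = 1 := by
    have : ℓ ≠ 0 := by norm_num [ℓ]
    field_simp; ring
  rw [e1, e2, integral_cantorFn, smul_eq_mul]; ring

/-- Ramps are interval integrable. [folklore] -/
private theorem intervalIntegrable_cR (a p q : ℝ) : IntervalIntegrable (cR a) volume p q :=
  (continuous_cR a).intervalIntegrable p q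

/-- `R a s = ∫_1^s cR a` for `1 ≤ a`: `0` for `s ≤ a`, `s - a - ℓ/2` for `s ≥ a + ℓ`. [folklore] -/
private def R (a s : ℝ) : ℝ := ∫ x in (1:ℝ)..s, cR a x

/-- `R a s = ∫₁ˢ cR a = 0` for `s ≤ a` (`a ≥ 1`). [folklore] -/
private theorem R_of_le {a s : ℝ} (ha : 1 ≤ a) (h : s ≤ a) : R a s = 0 := by
  unfold R
  rw [intervalIntegral.integral_congr (g := fun _ => (0:ℝ)) ?_]
  · simp
  · intro x hx
    have hx' : x ≤ a := by
      rcases le_total 1 s with h1 | h1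
      · rw [uIcc_of_le h1] at hx; exact hx.2.trans h
      · rw [uIcc_of_ge h1] at hx; exact hx.2.trans ha
    exact cR_of_le hx'

/-- `R a s = s - a - ℓ/2` past the ramp (the ramp has integral `ℓ/2`). [folklore] -/
private theorem R_of_ge {a s : ℝ} (ha : 1 ≤ a) (h : a + ℓ ≤ s) : R a s = s - a - ℓ / 2 := by
  have hℓ : (0:ℝ) < ℓ := by norm_num [ℓ]
  unfold R
  rw [← intervalIntegral.integral_add_adjacent_intervals (intervalIntegrable_cR a 1 a)
      (intervalIntegrable_cR a a s),
    ← intervalIntegral.integral_add_adjacent_intervals (intervalIntegrable_cR a a (a + ℓ))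
      (intervalIntegrable_cR a (a + ℓ) s)]
  have h1 : (∫ x in (1:ℝ)..a, cR a x) = 0 := by
    have := R_of_le ha le_rfl; unfold R at this; exact this
  have h3 : (∫ x in (a + ℓ)..s, cR a x) = s - (a + ℓ) := by
    rw [intervalIntegral.integral_congr (g := fun _ => (1:ℝ)) ?_]
    · simp
    · intro x hx
      rw [uIcc_of_le h] at hx
      exact cR_of_ge hx.1
  rw [h1, integral_cR_ramp, h3]; ring

/-- `R a` is monotone. [folklore] -/
private theorem R_mono {a : ℝ} : Monotone (R a) := by
  intro s t hst
  unfold R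
  rw [← intervalIntegral.integral_add_adjacent_intervals (intervalIntegrable_cR a 1 s)
      (intervalIntegrable_cR a s t)]
  have : 0 ≤ ∫ x in s..t, cR a x :=
    intervalIntegral.integral_nonneg hst fun x _ => (cR_mem_Icc a x).1
  linarith

/-- `R a ≥ 0` (for `a ≥ 1`). [folklore] -/
private theorem R_nonneg {a s : ℝ} (ha : 1 ≤ a) : 0 ≤ R a s := by
  rcases le_total s a with h | h
  · rw [R_of_le ha h]
  · have := R_mono (a := a) h
    rwa [R_of_le ha le_rfl] at this

/-- `R a s ≤ s - a` for `s ≥ a`. [folklore] -/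
private theorem R_le {a s : ℝ} (ha : 1 ≤ a) (h : a ≤ s) : R a s ≤ s - a := by
  unfold R
  rw [← intervalIntegral.integral_add_adjacent_intervals (intervalIntegrable_cR a 1 a)
      (intervalIntegrable_cR a a s)]
  have h1 : (∫ x in (1:ℝ)..a, cR a x) = 0 := by
    have := R_of_le ha le_rfl; unfold R at this; exact this
  have h2 : (∫ x in a..s, cR a x) ≤ ∫ x in a..s, (1:ℝ) :=
    intervalIntegral.integral_mono_on h (intervalIntegrable_cR a a s) (by simp)
      fun x _ => (cR_mem_Icc a x).2
  simp at h2
  linarith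

/-- `(R a)' = cR a`. [folklore] -/
private theorem hasDerivAt_R (a s : ℝ) : HasDerivAt (R a) (cR a s) s :=
  intervalIntegral.integral_hasDerivAt_right (intervalIntegrable_cR a 1 s)
    ((continuous_cR a).stronglyMeasurableAtFilter _ _) (continuous_cR a).continuousAt

/-- Integrated trapezoid. [folklore] -/
private def TR (a b s : ℝ) : ℝ := R a s - R b s

/-- `TR a b` vanishes left of `a`. [folklore] -/
private theorem TR_of_le {a b s : ℝ} (ha : 1 ≤ a) (hab : a ≤ b) (h : s ≤ a) : TR a b s = 0 := by
  rw [TR, R_of_le ha h, R_of_le (ha.trans hab) (h.trans hab)]; ring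

/-- `TR a b = b - a` right of `b + ℓ`. [folklore] -/
private theorem TR_of_ge {a b s : ℝ} (ha : 1 ≤ a) (hab : a + ℓ ≤ b) (h : b + ℓ ≤ s) :
    TR a b s = b - a := by
  have hℓ : (0:ℝ) < ℓ := by norm_num [ℓ]
  rw [TR, R_of_ge ha (by linarith), R_of_ge (by linarith) h]; ring

/-- `(TR a b)' = trap a b`. [folklore] -/
private theorem hasDerivAt_TR (a b s : ℝ) : HasDerivAt (TR a b) (trap a b s) s :=
  (hasDerivAt_R a s).sub (hasDerivAt_R b s)

/-- `TR a b` is monotone (its derivative `trap a b` is non-negative). [folklore] -/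
private theorem TR_monotoneOn_of {a b : ℝ} (hab : a ≤ b) : Monotone (TR a b) := by
  refine monotone_of_deriv_nonneg ?_ ?_ 
  · exact fun s => (hasDerivAt_TR a b s).differentiableAt
  · intro s; rw [(hasDerivAt_TR a b s).deriv]; exact trap_nonneg hab s

/-- `TR a b ≥ 0`. [folklore] -/
private theorem TR_nonneg {a b s : ℝ} (ha : 1 ≤ a) (hab : a ≤ b) : 0 ≤ TR a b s := by
  rcases le_total s a with h | h
  · rw [TR_of_le ha hab h]
  · have := TR_monotoneOn_of hab h
    rwa [TR_of_le ha hab le_rfl] at this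

/-- `TR a b ≤ b - a`. [folklore] -/
private theorem TR_le {a b s : ℝ} (ha : 1 ≤ a) (hab : a + ℓ ≤ b) : TR a b s ≤ b - a := by
  have hℓ : (0:ℝ) < ℓ := by norm_num [ℓ]
  rcases le_total s (b + ℓ) with h | h
  · have := TR_monotoneOn_of (by linarith : a ≤ b) h
    rwa [TR_of_ge ha hab le_rfl] at this
  · rw [TR_of_ge ha hab h]


/-! ### C. The example potential: data -/

variable (α : ℝ)

/-- The plateau value reached after the first ramp. [folklore] -/
private def Ptop : ℝ := 6 / α - 1 + 1 / (200 * α ^ 2)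

/-- The slope of the long descent (`σ · 0.28 = Ptop`). [folklore] -/
private def σ : ℝ := 25 / 7 * Ptop α

/-- Ramp start points (15 ramps of length `ℓ = 1/400`). [folklore] -/
private def pts : Fin 15 → ℝ :=
  ![1 + 2 * α, 101 / 100, 129 / 100, 267 / 200, 67 / 50, 543 / 400, 109 / 80, 31 / 20, 157 / 100,
    42 / 25, 17 / 10, 531 / 200, 133 / 50, 273 / 100, 547 / 200]

/-- Ramp coefficients (jumps of `v = V'`). [folklore] -/
private def cfs : Fin 15 → ℝ :=
  ![-(4 / α ^ 2), -σ α, σ α, -200000, 200000, 200000, -200000, 50, -50, -50, 50, 200000, -200000,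
    -200000, 200000]

/-- The core/well part of `v = V'`: `(4/α³) · clamp(s − 1, −α, α)`. [folklore] -/
private def v0 (s : ℝ) : ℝ := 4 / α ^ 3 * max (-α) (min α (s - 1))

/-- The ramp part of `v`. [folklore] -/
private def vr (s : ℝ) : ℝ := ∑ i, cfs α i * cR (pts α i) s

/-- `v = V'`. [folklore] -/
private def v (s : ℝ) : ℝ := v0 α s + vr α s

/-- The example pair potential `V(r) = −1 + ∫₁ʳ v`. [folklore] -/
def Vp (r : ℝ) : ℝ := -1 + ∫ x in (1:ℝ)..r, v α x

/-- `∫₁ʳ v0`. [folklore] -/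
private def W0 (r : ℝ) : ℝ := ∫ x in (1:ℝ)..r, v0 α x

/-- `∫₁ʳ vr = Σ cᵢ R(pᵢ)`. [folklore] -/
private def VR (r : ℝ) : ℝ := ∑ i, cfs α i * R (pts α i) r

variable {α}

/-! ### D. Continuity, the integral splits, derivative -/

/-- `v0` is continuous. [folklore] -/
private theorem continuous_v0 : Continuous (v0 α) := by
  unfold v0
  exact continuous_const.mul (continuous_const.max (continuous_const.min
    (continuous_id.sub continuous_const)))

/-- `vr` is continuous. [folklore] -/
private theorem continuous_vr : Continuous (vr α) := by
  unfold vr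
  exact continuous_finsetSum _ fun i _ => continuous_const.mul (continuous_cR _)

/-- `v` is continuous. [folklore] -/
private theorem continuous_v : Continuous (v α) := continuous_v0.add continuous_vr

/-- The integral of the ramp part splits as the corresponding combination of ramp integrals. [folklore] -/
private theorem intervalIntegral_vr (p q : ℝ) :
    ∫ x in p..q, vr α x = ∑ i, cfs α i * ∫ x in p..q, cR (pts α i) x := by
  unfold vr
  rw [intervalIntegral.integral_finsetSum]
  · refine Finset.sum_congr rfl fun i _ => ?_
    rw [intervalIntegral.integral_const_mul]
  · intro i _
    exact ((continuous_cR _).intervalIntegrable p q).const_mul _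

/-- `V = -1 + W0 + VR`. [folklore] -/
private theorem Vp_eq (r : ℝ) : Vp α r = -1 + W0 α r + VR α r := by
  unfold Vp W0 VR
  rw [show (fun x => v α x) = fun x => v0 α x + vr α x from rfl,
    intervalIntegral.integral_add (continuous_v0.intervalIntegrable 1 r)
      (continuous_vr.intervalIntegrable 1 r), intervalIntegral_vr]
  simp only [R]
  ring

/-- `V' = v` (fundamental theorem of calculus, `v` continuous). [folklore] -/
private theorem hasDerivAt_Vp (r : ℝ) : HasDerivAt (Vp α) (v α r) r := by
  unfold Vp
  exact (intervalIntegral.integral_hasDerivAt_right (continuous_v.intervalIntegrable 1 r)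
    (continuous_v.stronglyMeasurableAtFilter _ _) continuous_v.continuousAt).const_add (-1)

/-- `deriv V = v`. [folklore] -/
private theorem deriv_Vp : deriv (Vp α) = v α := funext fun r => (hasDerivAt_Vp r).deriv

/-- `V` is differentiable. [folklore] -/
private theorem differentiable_Vp : Differentiable ℝ (Vp α) := fun r => (hasDerivAt_Vp r).differentiableAt

/-- `V` is `C¹`. [folklore] -/
private theorem contDiff_Vp : ContDiff ℝ 1 (Vp α) :=
  contDiff_one_iff_deriv.mpr ⟨differentiable_Vp, by rw [deriv_Vp]; exact continuous_v⟩

/-- `V` is continuous. [folklore] -/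
private theorem continuous_Vp : Continuous (Vp α) := differentiable_Vp.continuous

/-- Normalisation `V(1) = -1`. [folklore] -/
@[simp] private theorem Vp_one : Vp α 1 = -1 := by simp [Vp]

/-! ### E. `W0` in closed form -/

/-- `v0 = -4/α²` left of the well. [folklore] -/
private theorem v0_of_le (hα : 0 < α) {s : ℝ} (hs : s ≤ 1 - α) : v0 α s = -(4 / α ^ 2) := by
  unfold v0
  rw [min_eq_right (by linarith), max_eq_left (by linarith)]
  field_simp

/-- `v0 = 4/α²` right of the well. [folklore] -/
private theorem v0_of_ge (hα : 0 < α) {s : ℝ} (hs : 1 + α ≤ s) : v0 α s = 4 / α ^ 2 := by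
  unfold v0
  rw [min_eq_left (by linarith), max_eq_right (by linarith)]
  field_simp

/-- `v0 = (4/α³)(s - 1)` on the well. [folklore] -/
private theorem v0_of_mem {s : ℝ} (hs : s ∈ Icc (1 - α) (1 + α)) :
    v0 α s = 4 / α ^ 3 * (s - 1) := by
  unfold v0
  rw [min_eq_right (by linarith [hs.2]), max_eq_right (by linarith [hs.1])]

/-- `W0 = (2/α³)(r-1)²` on the well. [folklore] -/
private theorem W0_of_mem (hα : 0 < α) {r : ℝ} (hr : r ∈ Icc (1 - α) (1 + α)) :
    W0 α r = 2 / α ^ 3 * (r - 1) ^ 2 := by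
  unfold W0
  have h : ∀ x ∈ uIcc 1 r, v0 α x = 4 / α ^ 3 * (x - 1) := by
    intro x hx
    refine v0_of_mem ⟨?_, ?_⟩
    · rcases le_total 1 r with h1 | h1
      · rw [uIcc_of_le h1] at hx; linarith [hx.1]
      · rw [uIcc_of_ge h1] at hx; linarith [hx.1, hr.1]
    · rcases le_total 1 r with h1 | h1
      · rw [uIcc_of_le h1] at hx; linarith [hx.2, hr.2]
      · rw [uIcc_of_ge h1] at hx; linarith [hx.2]
  rw [intervalIntegral.integral_congr h, intervalIntegral.integral_const_mul,
    intervalIntegral.integral_sub intervalIntegrable_id (intervalIntegrable_const),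
    integral_id, intervalIntegral.integral_const]
  simp only [smul_eq_mul, mul_one, one_pow]
  ring

/-- `W0` right of the well (affine). [folklore] -/
private theorem W0_of_ge (hα : 0 < α) {r : ℝ} (hr : 1 + α ≤ r) :
    W0 α r = 2 / α + 4 / α ^ 2 * (r - 1 - α) := by
  have hα' : α ≠ 0 := hα.ne'
  have h1 : W0 α (1 + α) = 2 / α := by
    rw [W0_of_mem hα ⟨by linarith, le_rfl⟩]; field_simp; ring
  unfold W0 at h1 ⊢
  rw [← intervalIntegral.integral_add_adjacent_intervals (continuous_v0.intervalIntegrable 1 (1 + α))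
      (continuous_v0.intervalIntegrable (1 + α) r), h1]
  have h : ∀ x ∈ uIcc (1 + α) r, v0 α x = 4 / α ^ 2 := by
    intro x hx; rw [uIcc_of_le hr] at hx; exact v0_of_ge hα hx.1
  rw [intervalIntegral.integral_congr h, intervalIntegral.integral_const, smul_eq_mul]
  ring

/-- `W0` left of the well (affine). [folklore] -/
private theorem W0_of_le (hα : 0 < α) {r : ℝ} (hr : r ≤ 1 - α) :
    W0 α r = 2 / α + 4 / α ^ 2 * (1 - α - r) := by
  have hα' : α ≠ 0 := hα.ne'
  have h1 : W0 α (1 - α) = 2 / α := by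
    rw [W0_of_mem hα ⟨le_rfl, by linarith⟩]; field_simp; ring
  unfold W0 at h1 ⊢
  rw [← intervalIntegral.integral_add_adjacent_intervals (continuous_v0.intervalIntegrable 1 (1 - α))
      (continuous_v0.intervalIntegrable (1 - α) r), h1]
  have h : ∀ x ∈ uIcc (1 - α) r, v0 α x = -(4 / α ^ 2) := by
    intro x hx; rw [uIcc_of_ge hr] at hx; exact v0_of_le hα hx.2
  rw [intervalIntegral.integral_congr h, intervalIntegral.integral_const, smul_eq_mul]
  ring


/-! ### F. The derivative of `v` -/

/-- If `f` is eventually constant to the right of `x`, then Lean's `deriv f x = 0` (either `f` is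
not differentiable at `x`, or its derivative equals the right derivative `0`). [folklore] -/
private theorem deriv_eq_zero_of_const_right {f : ℝ → ℝ} {x c : ℝ}
    (h : ∀ᶠ y in 𝓝[Ici x] x, f y = c) : deriv f x = 0 := by
  by_cases hf : DifferentiableAt ℝ f x
  · have h1 : HasDerivWithinAt f (deriv f x) (Ici x) x := hf.hasDerivAt.hasDerivWithinAt
    have hx : f x = c := h.self_of_nhdsWithin Set.self_mem_Ici
    have h2 : HasDerivWithinAt f 0 (Ici x) x :=
      (hasDerivWithinAt_const x (Ici x) c).congr_of_eventuallyEq h hx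
    exact (uniqueDiffWithinAt_Ici x).eq_deriv _ h1 h2
  · exact deriv_zero_of_not_differentiableAt hf

/-- Generic: a linear combination of Cantor ramps on pairwise separated ramp intervals has
`deriv = 0` everywhere. [folklore] -/
private theorem deriv_sum_cR_eq_zero {n : ℕ} (p c : Fin n → ℝ)
    (hsep : ∀ i j, i ≠ j → p i + ℓ < p j ∨ p j + ℓ < p i) (r : ℝ) :
    deriv (fun s => ∑ i, c i * cR (p i) s) r = 0 := by
  classical
  -- the constant value of an inactive ramp near `r`
  let e : Fin n → ℝ := fun j => if r < p j then 0 else 1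
  have hconst : ∀ j, r ∉ Icc (p j) (p j + ℓ) → (cR (p j)) =ᶠ[𝓝 r] fun _ => e j := by
    intro j hj
    rw [mem_Icc, not_and_or, not_le, not_le] at hj
    rcases hj with hj | hj
    · simp only [e, if_pos hj]; exact cR_eventuallyEq_zero hj
    · have : ¬ r < p j := by
        have : (0:ℝ) < ℓ := by norm_num [ℓ]
        push Not; linarith
      simp only [e, if_neg this]; exact cR_eventuallyEq_one hj
  by_cases hact : ∃ i, r ∈ Icc (p i) (p i + ℓ)
  · obtain ⟨i₀, hi₀⟩ := hact
    have hothers : ∀ j, j ≠ i₀ → r ∉ Icc (p j) (p j + ℓ) := by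
      intro j hj hr
      rcases hsep j i₀ hj with h | h
      · exact absurd (hr.2.trans_lt h) (not_lt.mpr hi₀.1)
      · exact absurd (hi₀.2.trans_lt h) (not_lt.mpr hr.1)
    let g : Fin n → ℝ → ℝ := fun j s => if j = i₀ then c j * cR (p j) s else c j * e j
    have hfg : (fun s => ∑ i, c i * cR (p i) s) =ᶠ[𝓝 r] fun s => ∑ i, g i s := by
      have hall : ∀ j, ∀ᶠ s in 𝓝 r, c j * cR (p j) s = g j s := by
        intro j
        by_cases hj : j = i₀
        · exact Filter.Eventually.of_forall fun s => by simp [g, hj]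
        · filter_upwards [hconst j (hothers j hj)] with s hs
          simp [g, hj, hs]
      filter_upwards [Filter.eventually_all.2 hall] with s hs
      exact Finset.sum_congr rfl fun j _ => hs j
    rw [hfg.deriv_eq]
    have hsplit : (fun s => ∑ i, g i s) =
        fun s => c i₀ * cR (p i₀) s + ∑ i ∈ Finset.univ.erase i₀, c i * e i := by
      funext s
      rw [← Finset.add_sum_erase _ _ (Finset.mem_univ i₀)]
      simp only [g, if_pos rfl]
      congr 1
      exact Finset.sum_congr rfl fun j hj => by rw [if_neg (Finset.ne_of_mem_erase hj)]
    rw [hsplit, deriv_add_const, deriv_const_mul_field, deriv_cR, mul_zero]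
  · push Not at hact
    have hfg : (fun s => ∑ i, c i * cR (p i) s) =ᶠ[𝓝 r] fun _ => ∑ i, c i * e i := by
      have hall : ∀ j, ∀ᶠ s in 𝓝 r, c j * cR (p j) s = c j * e j := by
        intro j
        filter_upwards [hconst j (hact j)] with s hs
        rw [hs]
      filter_upwards [Filter.eventually_all.2 hall] with s hs
      exact Finset.sum_congr rfl fun j _ => hs j
    rw [hfg.deriv_eq, deriv_const]

/-- The ramp start points are separated (for `α ≤ 1/400`). [folklore] -/
private theorem pts_lt_pts (hα1 : α ≤ 1 / 400) :
    ∀ i j : Fin 15, i < j → pts α i + ℓ < pts α j := by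
  intro i j hij
  fin_cases i <;> fin_cases j <;>
    first
    | exact absurd hij (by decide)
    | (simp only [pts, ℓ]; norm_num <;> linarith)

/-- The ramp intervals are pairwise separated (symmetric form). [folklore] -/
private theorem pts_sep (hα1 : α ≤ 1 / 400) :
    ∀ i j : Fin 15, i ≠ j → pts α i + ℓ < pts α j ∨ pts α j + ℓ < pts α i := by
  intro i j hij
  rcases lt_or_gt_of_ne hij with h | h
  · exact Or.inl (pts_lt_pts hα1 i j h)
  · exact Or.inr (pts_lt_pts hα1 j i h)

/-- Lean's `deriv` of the ramp part vanishes everywhere (Cantor staircases, separated ramps). [folklore] -/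
private theorem deriv_vr (hα1 : α ≤ 1 / 400) (r : ℝ) : deriv (vr α) r = 0 :=
  deriv_sum_cR_eq_zero (pts α) (cfs α) (pts_sep hα1) r

/-- Every ramp starts at `1 + 2α` or at a point `≥ 1.01`. [folklore] -/
private theorem one_le_pts (i : Fin 15) : 1 + 2 * α ≤ pts α i ∨ (101:ℝ) / 100 ≤ pts α i := by
  fin_cases i <;> simp [pts] <;> norm_num

/-- The ramp part vanishes on `(-∞, 1 + 2α]`. [folklore] -/
private theorem vr_of_le (hα1 : α ≤ 1 / 400) {s : ℝ} (hs : s ≤ 1 + 2 * α) : vr α s = 0 := by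
  unfold vr
  refine Finset.sum_eq_zero fun i _ => ?_
  have : s ≤ pts α i := by
    rcases one_le_pts (α := α) i with h | h <;> linarith
  rw [cR_of_le this, mul_zero]

/-- On the well, `deriv v = 4/α³ ≥ 1`. [folklore] -/
private theorem deriv_v_of_mem (hα : 0 < α) (hα1 : α ≤ 1 / 400) {r : ℝ} (hr : r ∈ Ioo (1 - α) (1 + α)) :
    deriv (v α) r = 4 / α ^ 3 := by
  have h : v α =ᶠ[𝓝 r] fun s => 4 / α ^ 3 * (s - 1) := by
    filter_upwards [Ioo_mem_nhds hr.1 hr.2] with s hs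
    rw [v, vr_of_le hα1 (by linarith [hs.2]), add_zero, v0_of_mem ⟨hs.1.le, hs.2.le⟩]
  rw [h.deriv_eq, deriv_const_mul_field]
  simp

/-- Right of the well, `deriv v = 0`. [folklore] -/
private theorem deriv_v_of_ge (hα : 0 < α) (hα1 : α ≤ 1 / 400) {r : ℝ} (hr : 1 + α ≤ r) :
    deriv (v α) r = 0 := by
  rcases hr.eq_or_lt with rfl | hr'
  · -- `v` is constant `4/α²` on `[1+α, 1+2α]`
    apply deriv_eq_zero_of_const_right (c := 4 / α ^ 2)
    have : Ico (1 + α) (1 + 2 * α) ∈ 𝓝[Ici (1 + α)] (1 + α) :=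
      Ico_mem_nhdsGE (by linarith)
    filter_upwards [this] with y hy
    rw [v, v0_of_ge hα hy.1, vr_of_le hα1 hy.2.le, add_zero]
  · have h : v α =ᶠ[𝓝 r] fun s => 4 / α ^ 2 + vr α s := by
      filter_upwards [Ioi_mem_nhds hr'] with s hs
      rw [v, v0_of_ge hα hs.le]
    rw [h.deriv_eq, deriv_const_add, deriv_vr hα1]

/-- `deriv (deriv V) = deriv v`. [folklore] -/
private theorem iteratedDeriv_two_Vp (r : ℝ) : deriv^[2] (Vp α) r = deriv (v α) r := by
  rw [Function.iterate_succ_apply, Function.iterate_one, deriv_Vp]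

/-! ### G. Values of `V` by region -/

/-- The fifteen-term sum `VR` written out. [folklore] -/
private theorem VR_expand (r : ℝ) : VR α r =
    -(4 / α ^ 2) * R (1 + 2 * α) r - σ α * R (101 / 100) r + σ α * R (129 / 100) r
    - 200000 * R (267 / 200) r + 200000 * R (67 / 50) r + 200000 * R (543 / 400) r
    - 200000 * R (109 / 80) r + 50 * R (31 / 20) r - 50 * R (157 / 100) r - 50 * R (42 / 25) r
    + 50 * R (17 / 10) r + 200000 * R (531 / 200) r - 200000 * R (133 / 50) r
    - 200000 * R (273 / 100) r + 200000 * R (547 / 200) r := by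
  simp [VR, Fin.sum_univ_succ, pts, cfs]
  ring

/-- The fifteen-term sum `vr` written out. [folklore] -/
private theorem vr_expand (s : ℝ) : vr α s =
    -(4 / α ^ 2) * cR (1 + 2 * α) s - σ α * cR (101 / 100) s + σ α * cR (129 / 100) s
    - 200000 * cR (267 / 200) s + 200000 * cR (67 / 50) s + 200000 * cR (543 / 400) s
    - 200000 * cR (109 / 80) s + 50 * cR (31 / 20) s - 50 * cR (157 / 100) s - 50 * cR (42 / 25) s
    + 50 * cR (17 / 10) s + 200000 * cR (531 / 200) s - 200000 * cR (133 / 50) s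
    - 200000 * cR (273 / 100) s + 200000 * cR (547 / 200) s := by
  simp [vr, Fin.sum_univ_succ, pts, cfs]
  ring

/-- The seven trapezoid primitives. [folklore] -/
private def TR₁ : ℝ → ℝ := TR (101 / 100) (129 / 100)
/-- Trapezoid primitive of the descent into the deep well. [folklore] -/
private def TR₂ : ℝ → ℝ := TR (267 / 200) (67 / 50)
/-- Trapezoid primitive of the ascent out of the deep well. [folklore] -/
private def TR₃ : ℝ → ℝ := TR (543 / 400) (109 / 80)
/-- Trapezoid primitive of the ascent to the selection bump. [folklore] -/
private def TR₄ : ℝ → ℝ := TR (31 / 20) (157 / 100)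
/-- Trapezoid primitive of the descent from the selection bump. [folklore] -/
private def TR₅ : ℝ → ℝ := TR (42 / 25) (17 / 10)
/-- Trapezoid primitive of the ascent to the compensating plateau. [folklore] -/
private def TR₆ : ℝ → ℝ := TR (531 / 200) (133 / 50)
/-- Trapezoid primitive of the descent from the compensating plateau. [folklore] -/
private def TR₇ : ℝ → ℝ := TR (273 / 100) (547 / 200)

/-- Head part of `V` (descent and deep well). [folklore] -/
private def Hd (α x : ℝ) : ℝ := Ptop α - σ α * TR₁ x - 200000 * TR₂ x + 200000 * TR₃ x

/-- Tail part of `V` (selection bump and compensating plateau). [folklore] -/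
private def Tl (x : ℝ) : ℝ := 50 * TR₄ x - 50 * TR₅ x + 200000 * TR₆ x - 200000 * TR₇ x

/-- `V` right of the well in terms of the trapezoid primitives. [folklore] -/
private theorem Vp_eq_TRs (hα : 0 < α) {r : ℝ} (hr : 1 + α ≤ r) :
    Vp α r = -1 + 2 / α + 4 / α ^ 2 * (r - 1 - α) - 4 / α ^ 2 * R (1 + 2 * α) r
      - σ α * TR₁ r - 200000 * TR₂ r + 200000 * TR₃ r + Tl r := by
  rw [Vp_eq, W0_of_ge hα hr, VR_expand]
  simp only [TR₁, TR₂, TR₃, Tl, TR₄, TR₅, TR₆, TR₇, TR]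
  ring

/-- Past the first ramp, `V = Hd + Tl`. [folklore] -/
private theorem Vp_eq_HT (hα : 0 < α) {r : ℝ} (hr : 1 + 2 * α + ℓ ≤ r) : Vp α r = Hd α r + Tl r := by
  have hℓ : (0:ℝ) < ℓ := by norm_num [ℓ]
  rw [Vp_eq_TRs hα (by linarith), R_of_ge (by linarith) hr, Hd, Ptop]
  simp only [ℓ]
  field_simp
  ring

/-- `Ptop ≥ 0`. [folklore] -/
private theorem Ptop_nonneg (hα : 0 < α) (hα1 : α ≤ 1 / 400) : 0 ≤ Ptop α := by
  unfold Ptop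
  have : 6 ≤ 6 / α := by rw [le_div_iff₀ hα]; nlinarith
  have : 0 ≤ 1 / (200 * α ^ 2) := by positivity
  linarith
/-- `σ ≥ 0`. [folklore] -/
private theorem σ_nonneg (hα : 0 < α) (hα1 : α ≤ 1 / 400) : 0 ≤ σ α := by
  unfold σ; have := Ptop_nonneg hα hα1; positivity

/-- `σ · (7/25) = Ptop`: the long descent ends exactly at `0`. [folklore] -/
private theorem σ_mul : σ α * (7 / 25) = Ptop α := by unfold σ; ring

-- numeric facts about the trapezoids
section TRfacts
variable {x : ℝ}

/-- `ℓ = 1/400` (for `norm_num`). [folklore] -/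
private theorem hℓ : ℓ = 1 / 400 := rfl

/-- `TR₁` is non-negative. [folklore] -/
private theorem TR₁_nonneg : 0 ≤ TR₁ x := TR_nonneg (by norm_num) (by norm_num)
/-- `TR₁` is at most its full value. [folklore] -/
private theorem TR₁_le : TR₁ x ≤ 7 / 25 := (TR_le (by norm_num) (by norm_num [hℓ])).trans (by norm_num)
/-- `TR₁` takes its full value right of its second ramp. [folklore] -/
private theorem TR₁_full (h : 517 / 400 ≤ x) : TR₁ x = 7 / 25 := by
  rw [TR₁, TR_of_ge (by norm_num) (by norm_num [hℓ]) (by norm_num [hℓ]; linarith)]; norm_num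
/-- `TR₂` is non-negative. [folklore] -/
private theorem TR₂_nonneg : 0 ≤ TR₂ x := TR_nonneg (by norm_num) (by norm_num)
/-- `TR₂` is at most its full value. [folklore] -/
private theorem TR₂_le : TR₂ x ≤ 1 / 200 := (TR_le (by norm_num) (by norm_num [hℓ])).trans (by norm_num)
/-- `TR₂` vanishes left of its first ramp. [folklore] -/
private theorem TR₂_zero (h : x ≤ 267 / 200) : TR₂ x = 0 := TR_of_le (by norm_num) (by norm_num) h
/-- `TR₂` takes its full value right of its second ramp. [folklore] -/
private theorem TR₂_full (h : 537 / 400 ≤ x) : TR₂ x = 1 / 200 := by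
  rw [TR₂, TR_of_ge (by norm_num) (by norm_num [hℓ]) (by norm_num [hℓ]; linarith)]; norm_num
/-- `TR₃` is non-negative. [folklore] -/
private theorem TR₃_nonneg : 0 ≤ TR₃ x := TR_nonneg (by norm_num) (by norm_num)
/-- `TR₃` is at most its full value. [folklore] -/
private theorem TR₃_le : TR₃ x ≤ 1 / 200 := (TR_le (by norm_num) (by norm_num [hℓ])).trans (by norm_num)
/-- `TR₃` vanishes left of its first ramp. [folklore] -/
private theorem TR₃_zero (h : x ≤ 543 / 400) : TR₃ x = 0 := TR_of_le (by norm_num) (by norm_num) h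
/-- `TR₃` takes its full value right of its second ramp. [folklore] -/
private theorem TR₃_full (h : 273 / 200 ≤ x) : TR₃ x = 1 / 200 := by
  rw [TR₃, TR_of_ge (by norm_num) (by norm_num [hℓ]) (by norm_num [hℓ]; linarith)]; norm_num
/-- `TR₄` is non-negative. [folklore] -/
private theorem TR₄_nonneg : 0 ≤ TR₄ x := TR_nonneg (by norm_num) (by norm_num)
/-- `TR₄` is at most its full value. [folklore] -/
private theorem TR₄_le : TR₄ x ≤ 1 / 50 := (TR_le (by norm_num) (by norm_num [hℓ])).trans (by norm_num)
/-- `TR₄` vanishes left of its first ramp. [folklore] -/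
private theorem TR₄_zero (h : x ≤ 31 / 20) : TR₄ x = 0 := TR_of_le (by norm_num) (by norm_num) h
/-- `TR₄` takes its full value right of its second ramp. [folklore] -/
private theorem TR₄_full (h : 629 / 400 ≤ x) : TR₄ x = 1 / 50 := by
  rw [TR₄, TR_of_ge (by norm_num) (by norm_num [hℓ]) (by norm_num [hℓ]; linarith)]; norm_num
/-- `TR₅` is non-negative. [folklore] -/
private theorem TR₅_nonneg : 0 ≤ TR₅ x := TR_nonneg (by norm_num) (by norm_num)
/-- `TR₅` is at most its full value. [folklore] -/
private theorem TR₅_le : TR₅ x ≤ 1 / 50 := (TR_le (by norm_num) (by norm_num [hℓ])).trans (by norm_num)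
/-- `TR₅` vanishes left of its first ramp. [folklore] -/
private theorem TR₅_zero (h : x ≤ 42 / 25) : TR₅ x = 0 := TR_of_le (by norm_num) (by norm_num) h
/-- `TR₅` takes its full value right of its second ramp. [folklore] -/
private theorem TR₅_full (h : 681 / 400 ≤ x) : TR₅ x = 1 / 50 := by
  rw [TR₅, TR_of_ge (by norm_num) (by norm_num [hℓ]) (by norm_num [hℓ]; linarith)]; norm_num
/-- `TR₆` is non-negative. [folklore] -/
private theorem TR₆_nonneg : 0 ≤ TR₆ x := TR_nonneg (by norm_num) (by norm_num)
/-- `TR₆` is at most its full value. [folklore] -/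
private theorem TR₆_le : TR₆ x ≤ 1 / 200 := (TR_le (by norm_num) (by norm_num [hℓ])).trans (by norm_num)
/-- `TR₆` vanishes left of its first ramp. [folklore] -/
private theorem TR₆_zero (h : x ≤ 531 / 200) : TR₆ x = 0 := TR_of_le (by norm_num) (by norm_num) h
/-- `TR₆` takes its full value right of its second ramp. [folklore] -/
private theorem TR₆_full (h : 213 / 80 ≤ x) : TR₆ x = 1 / 200 := by
  rw [TR₆, TR_of_ge (by norm_num) (by norm_num [hℓ]) (by norm_num [hℓ]; linarith)]; norm_num
/-- `TR₇` is non-negative. [folklore] -/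
private theorem TR₇_nonneg : 0 ≤ TR₇ x := TR_nonneg (by norm_num) (by norm_num)
/-- `TR₇` is at most its full value. [folklore] -/
private theorem TR₇_le : TR₇ x ≤ 1 / 200 := (TR_le (by norm_num) (by norm_num [hℓ])).trans (by norm_num)
/-- `TR₇` vanishes left of its first ramp. [folklore] -/
private theorem TR₇_zero (h : x ≤ 273 / 100) : TR₇ x = 0 := TR_of_le (by norm_num) (by norm_num) h
/-- `TR₇` takes its full value right of its second ramp. [folklore] -/
private theorem TR₇_full (h : 219 / 80 ≤ x) : TR₇ x = 1 / 200 := by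
  rw [TR₇, TR_of_ge (by norm_num) (by norm_num [hℓ]) (by norm_num [hℓ]; linarith)]; norm_num

end TRfacts

/-! #### The head `Hd` -/

/-- The head is `≥ -1000`. [folklore] -/
private theorem Hd_ge (hα : 0 < α) (hα1 : α ≤ 1 / 400) (x : ℝ) : -1000 ≤ Hd α x := by
  unfold Hd
  have hσ := σ_nonneg hα hα1
  have e := σ_mul (α := α)
  rcases le_or_gt x (543 / 400) with h | h
  · rw [TR₃_zero h]
    nlinarith [TR₁_le (x := x), TR₂_le (x := x), TR₂_nonneg (x := x)]
  · rw [TR₁_full (by linarith), TR₂_full (by linarith)]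
    nlinarith [TR₃_nonneg (x := x)]

/-- The head is `≥ 0` left of the deep well. [folklore] -/
private theorem Hd_nonneg_of_le (hα : 0 < α) (hα1 : α ≤ 1 / 400) {x : ℝ} (h : x ≤ 267 / 200) :
    0 ≤ Hd α x := by
  unfold Hd
  rw [TR₂_zero h, TR₃_zero (by linarith)]
  have hσ := σ_nonneg hα hα1
  nlinarith [TR₁_le (x := x), σ_mul (α := α)]

/-- The head vanishes between the long descent and the deep well. [folklore] -/
private theorem Hd_eq_zero_of_mem {x : ℝ} (h1 : 517 / 400 ≤ x) (h2 : x ≤ 267 / 200) : Hd α x = 0 := by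
  unfold Hd
  rw [TR₁_full h1, TR₂_zero h2, TR₃_zero (by linarith), σ_mul]; ring

/-- The head vanishes right of the deep well. [folklore] -/
private theorem Hd_eq_zero_of_ge {x : ℝ} (h : 273 / 200 ≤ x) : Hd α x = 0 := by
  unfold Hd
  rw [TR₁_full (by linarith), TR₂_full (by linarith), TR₃_full h, σ_mul]; ring

/-- The head equals `-1000` at the centre `27/20` of the deep well. [folklore] -/
private theorem Hd_wellCentre : Hd α (27 / 20) = -1000 := by
  unfold Hd
  rw [TR₁_full (by norm_num), TR₂_full (by norm_num), TR₃_zero (by norm_num), σ_mul]; ring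

/-! #### The tail `Tl` -/

/-- The tail is non-negative. [folklore] -/
private theorem Tl_nonneg (x : ℝ) : 0 ≤ Tl x := by
  unfold Tl
  rcases le_or_gt x (42 / 25) with h1 | h1
  · rw [TR₅_zero h1, TR₆_zero (by linarith), TR₇_zero (by linarith)]
    linarith [TR₄_nonneg (x := x)]
  rw [TR₄_full (by linarith)]
  rcases le_or_gt x (531 / 200) with h2 | h2
  · rw [TR₆_zero h2, TR₇_zero (by linarith)]
    linarith [TR₅_le (x := x)]
  rw [TR₅_full (by linarith)]
  rcases le_or_gt x (273 / 100) with h3 | h3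
  · rw [TR₇_zero h3]
    linarith [TR₆_nonneg (x := x)]
  rw [TR₆_full (by linarith)]
  linarith [TR₇_le (x := x)]

/-- The tail vanishes left of the selection bump. [folklore] -/
private theorem Tl_eq_zero_of_le {x : ℝ} (h : x ≤ 31 / 20) : Tl x = 0 := by
  unfold Tl
  rw [TR₄_zero h, TR₅_zero (by linarith), TR₆_zero (by linarith), TR₇_zero (by linarith)]; ring

/-- The tail equals `1` on the selection bump. [folklore] -/
private theorem Tl_eq_one {x : ℝ} (h1 : 629 / 400 ≤ x) (h2 : x ≤ 42 / 25) : Tl x = 1 := by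
  unfold Tl
  rw [TR₄_full h1, TR₅_zero h2, TR₆_zero (by linarith), TR₇_zero (by linarith)]; ring

/-- The tail vanishes between the selection bump and the plateau. [folklore] -/
private theorem Tl_eq_zero_of_mem {x : ℝ} (h1 : 681 / 400 ≤ x) (h2 : x ≤ 531 / 200) : Tl x = 0 := by
  unfold Tl
  rw [TR₄_full (by linarith), TR₅_full h1, TR₆_zero h2, TR₇_zero (by linarith)]; ring

/-- The tail equals `1000` on the compensating plateau. [folklore] -/
private theorem Tl_plateau {x : ℝ} (h1 : 213 / 80 ≤ x) (h2 : x ≤ 273 / 100) : Tl x = 1000 := by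
  unfold Tl
  rw [TR₄_full (by linarith), TR₅_full (by linarith), TR₆_full h1, TR₇_zero h2]; ring

/-- The tail vanishes right of the plateau. [folklore] -/
private theorem Tl_eq_zero_of_ge {x : ℝ} (h : 219 / 80 ≤ x) : Tl x = 0 := by
  unfold Tl
  rw [TR₄_full (by linarith), TR₅_full (by linarith), TR₆_full (by linarith), TR₇_full h]; ring

/-! #### Consequences for `V` -/

/-- `VR` vanishes on `(-∞, 1 + 2α]`. [folklore] -/
private theorem VR_of_le (hα : 0 < α) (hα1 : α ≤ 1 / 400) {r : ℝ} (hr : r ≤ 1 + 2 * α) :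
    VR α r = 0 := by
  unfold VR
  refine Finset.sum_eq_zero fun i _ => ?_
  have h1 : 1 ≤ pts α i := by
    rcases one_le_pts (α := α) i with h | h <;> linarith
  have : r ≤ pts α i := by rcases one_le_pts (α := α) i with h | h <;> linarith
  rw [R_of_le h1 this, mul_zero]

/-- Core: `V ≥ 2/α − 1` on `[0, 1 − α]` (indeed for all `r ≤ 1 − α`). [folklore] -/
private theorem Vp_core (hα : 0 < α) (hα1 : α ≤ 1 / 400) {r : ℝ} (hr : r ≤ 1 - α) :
    2 / α - 1 ≤ Vp α r := by
  rw [Vp_eq, W0_of_le hα hr, VR_of_le hα hα1 (by linarith)]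
  have : 0 ≤ 4 / α ^ 2 * (1 - α - r) := by positivity
  linarith

/-- Well: `V = −1 + (2/α³)(r−1)²` on `[1−α, 1+α]`. [folklore] -/
private theorem Vp_well (hα : 0 < α) (hα1 : α ≤ 1 / 400) {r : ℝ} (hr : r ∈ Icc (1 - α) (1 + α)) :
    Vp α r = -1 + 2 / α ^ 3 * (r - 1) ^ 2 := by
  rw [Vp_eq, W0_of_mem hα hr, VR_of_le hα hα1 (by linarith [hr.2])]; ring

/-- `V ≥ -1` on the well. [folklore] -/
private theorem Vp_well_ge (hα : 0 < α) (hα1 : α ≤ 1 / 400) {r : ℝ} (hr : r ∈ Icc (1 - α) (1 + α)) :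
    -1 ≤ Vp α r := by
  rw [Vp_well hα hα1 hr]; have : 0 ≤ 2 / α ^ 3 * (r - 1) ^ 2 := by positivity
  linarith

/-- Between the well and the end of the first ramp `V ≥ 0`. [folklore] -/
private theorem Vp_nonneg_mid (hα : 0 < α) (hα1 : α ≤ 1 / 400) {r : ℝ} (h1 : 1 + α ≤ r)
    (h2 : r ≤ 1 + 2 * α + ℓ) : 0 ≤ Vp α r := by
  rw [Vp_eq_TRs hα h1, show TR₁ r = 0 from TR_of_le (by norm_num) (by norm_num)
      (by norm_num [ℓ] at h2 ⊢; linarith),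
    TR₂_zero (by norm_num [ℓ] at h2 ⊢; linarith), TR₃_zero (by norm_num [ℓ] at h2 ⊢; linarith),
    Tl_eq_zero_of_le (by norm_num [ℓ] at h2 ⊢; linarith)]
  have hRle : R (1 + 2 * α) r ≤ max 0 (r - (1 + 2 * α)) := by
    rcases le_or_gt r (1 + 2 * α) with h | h
    · rw [R_of_le (by linarith) h]; exact le_max_left _ _
    · exact (R_le (by linarith) h.le).trans (le_max_right _ _)
  have h4 : 0 ≤ 4 / α ^ 2 := by positivity
  have h2a : 2 / α ≥ 2 * 400 := by rw [ge_iff_le, le_div_iff₀ hα]; nlinarith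
  rcases le_or_gt r (1 + 2 * α) with h | h
  · rw [max_eq_left (by linarith)] at hRle
    have := R_nonneg (a := 1 + 2 * α) (s := r) (by linarith)
    nlinarith
  · rw [max_eq_right (by linarith)] at hRle
    have : 4 / α ^ 2 * (r - 1 - α) - 4 / α ^ 2 * R (1 + 2 * α) r ≥ 4 / α ^ 2 * α := by
      nlinarith
    have : 4 / α ^ 2 * α = 4 / α := by field_simp
    nlinarith

/-- Global lower bound past the first ramp. [folklore] -/
private theorem Vp_ge_past (hα : 0 < α) (hα1 : α ≤ 1 / 400) {r : ℝ} (hr : 1 + 2 * α + ℓ ≤ r) :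
    -1000 ≤ Vp α r := by
  rw [Vp_eq_HT hα hr]; linarith [Hd_ge hα hα1 r, Tl_nonneg r]

/-- Past the first ramp and off the deep well `(1.335, 1.365)`, `V ≥ 0`. [folklore] -/
private theorem Vp_nonneg_past (hα : 0 < α) (hα1 : α ≤ 1 / 400) {r : ℝ} (hr : 1 + 2 * α + ℓ ≤ r)
    (h : r ≤ 267 / 200 ∨ 273 / 200 ≤ r) : 0 ≤ Vp α r := by
  rw [Vp_eq_HT hα hr]
  rcases h with h | h
  · linarith [Hd_nonneg_of_le hα hα1 h, Tl_nonneg r]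
  · rw [Hd_eq_zero_of_ge h]; linarith [Tl_nonneg r]

/-- `V(27/20) = -1000` (the deep well). [folklore] -/
private theorem Vp_wellCentre (hα : 0 < α) (hα1 : α ≤ 1 / 400) : Vp α (27 / 20) = -1000 := by
  rw [Vp_eq_HT hα (by norm_num [ℓ]; linarith), Hd_wellCentre, Tl_eq_zero_of_le (by norm_num)]
  ring

/-- `V = 1000` on the compensating plateau `[2.6625, 2.73]`. [folklore] -/
private theorem Vp_plateau (hα : 0 < α) (hα1 : α ≤ 1 / 400) {r : ℝ} (h1 : 213 / 80 ≤ r)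
    (h2 : r ≤ 273 / 100) : Vp α r = 1000 := by
  rw [Vp_eq_HT hα (by norm_num [ℓ]; linarith), Hd_eq_zero_of_ge (by linarith), Tl_plateau h1 h2]
  ring

/-- `V = 1` on the selection bump `[1.5725, 1.68]` (which contains `√(8/3)`). [folklore] -/
private theorem Vp_bump (hα : 0 < α) (hα1 : α ≤ 1 / 400) {r : ℝ} (h1 : 629 / 400 ≤ r)
    (h2 : r ≤ 42 / 25) : Vp α r = 1 := by
  rw [Vp_eq_HT hα (by norm_num [ℓ]; linarith), Hd_eq_zero_of_ge (by linarith), Tl_eq_one h1 h2]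
  ring

/-- `V = 0` on `[1.2925, 1.335]`. [folklore] -/
private theorem Vp_zero₁ (hα : 0 < α) (hα1 : α ≤ 1 / 400) {r : ℝ} (h1 : 517 / 400 ≤ r)
    (h2 : r ≤ 267 / 200) : Vp α r = 0 := by
  rw [Vp_eq_HT hα (by norm_num [ℓ]; linarith), Hd_eq_zero_of_mem h1 h2,
    Tl_eq_zero_of_le (by linarith)]; ring

/-- `V = 0` on `[1.365, 1.55]` (which contains `√2`). [folklore] -/
private theorem Vp_zero₂ (hα : 0 < α) (hα1 : α ≤ 1 / 400) {r : ℝ} (h1 : 273 / 200 ≤ r)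
    (h2 : r ≤ 31 / 20) : Vp α r = 0 := by
  rw [Vp_eq_HT hα (by norm_num [ℓ]; linarith), Hd_eq_zero_of_ge h1, Tl_eq_zero_of_le h2]; ring

/-- `V = 0` on `[1.7025, 2.655]` (which contains `√3, 2, √5, √6, √7`). [folklore] -/
private theorem Vp_zero₃ (hα : 0 < α) (hα1 : α ≤ 1 / 400) {r : ℝ} (h1 : 681 / 400 ≤ r)
    (h2 : r ≤ 531 / 200) : Vp α r = 0 := by
  rw [Vp_eq_HT hα (by norm_num [ℓ]; linarith), Hd_eq_zero_of_ge (by linarith),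
    Tl_eq_zero_of_mem h1 h2]; ring

/-- `V = 0` on `[2.7375, ∞)` (which contains `√q`, `q ≥ 8`). [folklore] -/
private theorem Vp_zero₄ (hα : 0 < α) (hα1 : α ≤ 1 / 400) {r : ℝ} (h : 219 / 80 ≤ r) : Vp α r = 0 := by
  rw [Vp_eq_HT hα (by norm_num [ℓ]; linarith), Hd_eq_zero_of_ge (by linarith),
    Tl_eq_zero_of_ge h]; ring

/-- Summary: `V ≥ 0` away from the two wells. [folklore] -/
private theorem Vp_nonneg_of (hα : 0 < α) (hα1 : α ≤ 1 / 400) {r : ℝ}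
    (h1 : r ≤ 1 - α ∨ 1 + α ≤ r) (h2 : r ≤ 267 / 200 ∨ 273 / 200 ≤ r) : 0 ≤ Vp α r := by
  rcases h1 with h1 | h1
  · have h2a : 2 / α ≥ 2 * 400 := by rw [ge_iff_le, le_div_iff₀ hα]; nlinarith
    linarith [Vp_core hα hα1 h1]
  rcases le_or_gt r (1 + 2 * α + ℓ) with h3 | h3
  · exact Vp_nonneg_mid hα hα1 h1 h3
  · exact Vp_nonneg_past hα hα1 h3.le h2

/-- Summary: `V ≥ −1000` everywhere on `[0, ∞)`. [folklore] -/
private theorem Vp_ge (hα : 0 < α) (hα1 : α ≤ 1 / 400) (r : ℝ) : -1000 ≤ Vp α r := by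
  rcases le_or_gt r (1 - α) with h1 | h1
  · linarith [Vp_nonneg_of hα hα1 (Or.inl h1) (Or.inl (by linarith))]
  rcases le_or_gt r (1 + α) with h2 | h2
  · linarith [Vp_well_ge hα hα1 ⟨h1.le, h2⟩]
  rcases le_or_gt r (1 + 2 * α + ℓ) with h3 | h3
  · linarith [Vp_nonneg_mid hα hα1 h2.le h3]
  · exact Vp_ge_past hα hα1 h3.le

/-! ### H. `V` at the fcc distances; the analytic fields of `IsLocalizedPair` -/

/-- `a ≤ √b` from `a² ≤ b`. [folklore] -/
private theorem le_sqrt_of_sq_le {a b : ℝ} (ha : 0 ≤ a) (h : a ^ 2 ≤ b) : a ≤ √b := by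
  rw [← Real.sqrt_sq ha]; exact Real.sqrt_le_sqrt h

/-- `√a ≤ b` from `a ≤ b²`. [folklore] -/
private theorem sqrt_le_of_le_sq {a b : ℝ} (hb : 0 ≤ b) (h : a ≤ b ^ 2) : √a ≤ b := by
  rw [← Real.sqrt_sq hb]; exact Real.sqrt_le_sqrt h

/-- `V(√q) = 0` for every integer `q ≥ 2` (all fcc distances except the nearest-neighbour one). [folklore] -/
private theorem Vp_sqrt_eq_zero (hα : 0 < α) (hα1 : α ≤ 1 / 400) {q : ℤ} (hq : 2 ≤ q) :
    Vp α (√(q : ℝ)) = 0 := by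
  rcases (show q = 2 ∨ (3 ≤ q ∧ q ≤ 7) ∨ 8 ≤ q by omega) with h | h | h
  · subst h
    exact Vp_zero₂ hα hα1 (le_sqrt_of_sq_le (by norm_num) (by norm_num))
      (sqrt_le_of_le_sq (by norm_num) (by norm_num))
  · have h3 : (3:ℝ) ≤ q := by exact_mod_cast h.1
    have h7 : (q:ℝ) ≤ 7 := by exact_mod_cast h.2
    exact Vp_zero₃ hα hα1 (le_sqrt_of_sq_le (by norm_num) (by norm_num; linarith))
      (sqrt_le_of_le_sq (by norm_num) (by norm_num; linarith))
  · have h8 : (8:ℝ) ≤ q := by exact_mod_cast h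
    exact Vp_zero₄ hα hα1 (le_sqrt_of_sq_le (by norm_num) (by norm_num; linarith))

/-- `V(√(8/3)) = 1`. [folklore] -/
private theorem Vp_sqrt_eight_thirds (hα : 0 < α) (hα1 : α ≤ 1 / 400) : Vp α (√(8 / 3)) = 1 :=
  Vp_bump hα hα1 (le_sqrt_of_sq_le (by norm_num) (by norm_num))
    (sqrt_le_of_le_sq (by norm_num) (by norm_num))

/-- `V(√3) = 0`. [folklore] -/
private theorem Vp_sqrt_three (hα : 0 < α) (hα1 : α ≤ 1 / 400) : Vp α (√3) = 0 :=
  Vp_zero₃ hα hα1 (le_sqrt_of_sq_le (by norm_num) (by norm_num))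
    (sqrt_le_of_le_sq (by norm_num) (by norm_num))

/-- `V = 0` eventually at `+∞`. [folklore] -/
private theorem Vp_eventually_zero (hα : 0 < α) (hα1 : α ≤ 1 / 400) : ∀ᶠ r in atTop, Vp α r = 0 :=
  (Filter.eventually_ge_atTop (219 / 80)).mono fun _ hr => Vp_zero₄ hα hα1 hr

/-- `V(r) → 0` as `r → ∞`. [folklore] -/
private theorem tendsto_Vp (hα : 0 < α) (hα1 : α ≤ 1 / 400) : Tendsto (Vp α) atTop (𝓝 0) :=
  tendsto_const_nhds.congr' ((Vp_eventually_zero hα hα1).mono fun _ hr => hr.symm)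

/-- The fcc-selection inequality `√α ≤ V(√(8/3)) - 3 V(√3)` (`= 1`). [folklore] -/
private theorem Vp_fcc_selection (hα : 0 < α) (hα1 : α ≤ 1 / 400) :
    Real.sqrt α ≤ Vp α (√(8 / 3)) - 3 * Vp α (√3) := by
  rw [Vp_sqrt_eight_thirds hα hα1, Vp_sqrt_three hα hα1]
  have : √α ≤ 1 := sqrt_le_of_le_sq (by norm_num) (by linarith)
  linarith

/-- Core: `V ≥ 1/α` on `[0, 1-α]`. [folklore] -/
private theorem Vp_core_field (hα : 0 < α) (hα1 : α ≤ 1 / 400) :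
    ∀ r ∈ Icc (0:ℝ) (1 - α), 1 / α ≤ Vp α r := by
  intro r hr
  have h := Vp_core hα hα1 hr.2
  have h1 : 1 ≤ 1 / α := by rw [le_div_iff₀ hα]; linarith
  have h2 : 2 / α = 1 / α + 1 / α := by ring
  linarith

/-- Well: `deriv^[2] V = 4/α³ ≥ 1` on `(1-α, 1+α)` (a genuine second derivative there). [folklore] -/
private theorem Vp_convex_field (hα : 0 < α) (hα1 : α ≤ 1 / 400) :
    ∀ r ∈ Ioo (1 - α) (1 + α), 1 ≤ deriv^[2] (Vp α) r := by
  intro r hr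
  rw [iteratedDeriv_two_Vp, deriv_v_of_mem hα hα1 hr, le_div_iff₀ (by positivity)]
  have : α ^ 3 ≤ 1 := pow_le_one₀ hα.le (by linarith)
  linarith

/-- `V` vanishes near `√3`. [folklore] -/
private theorem Vp_eventuallyEq_zero_sqrt_three (hα : 0 < α) (hα1 : α ≤ 1 / 400) :
    Vp α =ᶠ[𝓝 (√3)] fun _ => 0 := by
  have h1 : (681 / 400 : ℝ) < √3 :=
    lt_of_lt_of_le (by norm_num) (le_sqrt_of_sq_le (by norm_num) (by norm_num : (1703/1000:ℝ)^2 ≤ 3))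
  have h2 : √3 < (531 / 200 : ℝ) :=
    lt_of_le_of_lt (sqrt_le_of_le_sq (by norm_num) (by norm_num : (3:ℝ) ≤ (7/4)^2)) (by norm_num)
  filter_upwards [Ioo_mem_nhds h1 h2] with x hx
  exact Vp_zero₃ hα hα1 hx.1.le hx.2.le

/-- `V'(√3) = 0`. [folklore] -/
private theorem Vp_deriv_sqrt_three (hα : 0 < α) (hα1 : α ≤ 1 / 400) : deriv (Vp α) (√3) = 0 := by
  rw [(Vp_eventuallyEq_zero_sqrt_three hα hα1).deriv_eq, deriv_const]

/-- (2.7) as transcribed: `|deriv^[2] V| = 0 ≤ α^{1/4}` on `[1+α, √(7/2)]`. [folklore] -/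
private theorem Vp_medium_field (hα : 0 < α) (hα1 : α ≤ 1 / 400) :
    ∀ r ∈ Icc (1 + α) (√(7 / 2)), |deriv^[2] (Vp α) r| ≤ α ^ (1 / 4 : ℝ) := by
  intro r hr
  rw [iteratedDeriv_two_Vp, deriv_v_of_ge hα hα1 hr.1, abs_zero]
  exact Real.rpow_nonneg hα.le _

/-- (2.8) as transcribed: `|deriv^[2] V| = 0 ≤ α r⁻¹⁰` on `[√(7/2), ∞)`. [folklore] -/
private theorem Vp_decay_field (hα : 0 < α) (hα1 : α ≤ 1 / 400) :
    ∀ r : ℝ, √(7 / 2) ≤ r → |deriv^[2] (Vp α) r| ≤ α * r⁻¹ ^ 10 := by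
  intro r hr
  have h54 := five_fourths_le_sqrt_seven_halves
  rw [iteratedDeriv_two_Vp, deriv_v_of_ge hα hα1 (by linarith), abs_zero]
  have : 0 < r := by linarith
  positivity


/-! ### I. Lattice bookkeeping -/

/-- `|fccPoint a|²` as an integer quadratic form. [folklore] -/
private def Qh (a : Fin 3 → ℤ) : ℤ := a 0 ^ 2 + a 1 ^ 2 + a 2 ^ 2 + a 0 * a 1 + a 0 * a 2 + a 1 * a 2

/-- `|fccPoint a|² = Qh a`. [folklore] -/
private theorem normSq_fcc (a : Fin 3 → ℤ) : ‖fccPoint a‖ ^ 2 = (Qh a : ℝ) := by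
  rw [norm_fccPoint_sq]; push_cast; simp only [Qh]; push_cast; ring

/-- `|fccPoint a| = √(Qh a)`. [folklore] -/
private theorem norm_fcc (a : Fin 3 → ℤ) : ‖fccPoint a‖ = √(Qh a : ℝ) := by
  rw [← normSq_fcc, Real.sqrt_sq (norm_nonneg _)]

/-- `Qh a ≥ 0`. [folklore] -/
private theorem Qh_nonneg (a : Fin 3 → ℤ) : 0 ≤ Qh a := by
  have h := normSq_fcc a
  have : (0:ℝ) ≤ Qh a := by rw [← h]; positivity
  exact_mod_cast this

/-- `Qh a = 0 ↔ a = 0`. [folklore] -/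
private theorem Qh_eq_zero_iff (a : Fin 3 → ℤ) : Qh a = 0 ↔ a = 0 := by
  constructor
  · intro h
    have h1 : ‖fccPoint a‖ ^ 2 = 0 := by rw [normSq_fcc, h]; simp
    have h2 : fccPoint a = 0 := by simpa using h1
    exact fccPoint_injective (by rw [h2, map_zero])
  · rintro rfl; simp [Qh]

/-- `Qh a ≥ 1` for `a ≠ 0`: fcc distances are `≥ 1`. [folklore] -/
private theorem one_le_Qh {a : Fin 3 → ℤ} (ha : a ≠ 0) : 1 ≤ Qh a := by
  have h1 := Qh_nonneg a
  have h2 : Qh a ≠ 0 := fun h => ha ((Qh_eq_zero_iff a).1 h)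
  omega

/-- `|fccPoint a| ≥ 1` for `a ≠ 0`. [folklore] -/
private theorem one_le_norm_fcc {a : Fin 3 → ℤ} (ha : a ≠ 0) : 1 ≤ ‖fccPoint a‖ := by
  have h1 : (1:ℝ) ≤ Qh a := by exact_mod_cast one_le_Qh ha
  rw [norm_fcc]
  exact le_sqrt_of_sq_le (by norm_num) (by simpa using h1)

/-- Coordinates are controlled by the norm: `aᵢ² ≤ 2 Qh a`. [folklore] -/
private theorem sq_le_two_Qh (a : Fin 3 → ℤ) (i : Fin 3) : a i ^ 2 ≤ 2 * Qh a := by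
  have h : ∀ j : Fin 3, j = 0 ∨ j = 1 ∨ j = 2 := by decide
  rcases h i with rfl | rfl | rfl <;> simp only [Qh] <;>
    nlinarith [sq_nonneg (a 0 + a 1 + a 2), sq_nonneg (a 0), sq_nonneg (a 1), sq_nonneg (a 2)]

/-- The cube `[-n, n]³ ⊂ ℤ³`. [folklore] -/
private def box (n : ℕ) : Finset (Fin 3 → ℤ) := Fintype.piFinset fun _ => Finset.Icc (-(n:ℤ)) n

/-- Membership in the cube. [folklore] -/
private theorem mem_box {n : ℕ} {a : Fin 3 → ℤ} : a ∈ box n ↔ ∀ i, -(n:ℤ) ≤ a i ∧ a i ≤ n := by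
  simp [box, Fintype.mem_piFinset]

/-- The cube of half-width `n` has `(2n+1)³` points. [folklore] -/
private theorem card_box (n : ℕ) : (box n).card = (2 * n + 1) ^ 3 := by
  rw [box, Fintype.card_piFinset, Finset.prod_const, Finset.card_univ, Fintype.card_fin,
    Int.card_Icc]
  congr 1; omega

/-- `0` is in every cube. [folklore] -/
private theorem zero_mem_box (n : ℕ) : (0 : Fin 3 → ℤ) ∈ box n := by
  rw [mem_box]; intro i; simp

/-- A lattice point of norm `≤ t` lies in the cube of half-width `n` as soon as `2t < n+1`. [folklore] -/
private theorem mem_box_of_norm_le {a : Fin 3 → ℤ} {t : ℝ} {n : ℕ} (ht : ‖fccPoint a‖ ≤ t)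
    (hn : 2 * t < n + 1) : a ∈ box n := by
  rw [mem_box]
  intro i
  have h0 : 0 ≤ t := (norm_nonneg _).trans ht
  have h1 : (a i : ℝ) ^ 2 ≤ (2 * t) ^ 2 := by
    have := sq_le_two_Qh a i
    have h2 : ((a i) ^ 2 : ℝ) ≤ 2 * Qh a := by exact_mod_cast this
    rw [← normSq_fcc] at h2
    nlinarith [norm_nonneg (fccPoint a)]
  obtain ⟨h3, h4⟩ := abs_le_of_sq_le_sq' h1 (by linarith)
  have h5 : (a i : ℝ) < n + 1 := by linarith
  have h6 : (-(n:ℝ) - 1) < a i := by linarith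
  have h5' : a i < (n:ℤ) + 1 := by exact_mod_cast h5
  have h6' : -(n:ℤ) - 1 < a i := by exact_mod_cast h6
  constructor <;> omega

/-- Points of the cube of half-width `m` have `|fccPoint a|² ≤ 6 m²`. [folklore] -/
private theorem normSq_le_of_mem_box {a : Fin 3 → ℤ} {m : ℕ} (h : a ∈ box m) :
    ‖fccPoint a‖ ^ 2 ≤ 6 * (m:ℝ) ^ 2 := by
  rw [normSq_fcc]
  rw [mem_box] at h
  have h0 := h 0; have h1 := h 1; have h2 := h 2
  have : Qh a ≤ 6 * (m:ℤ) ^ 2 := by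
    simp only [Qh]
    nlinarith [abs_le.mpr ⟨by linarith [h0.1], h0.2⟩, abs_le.mpr ⟨by linarith [h1.1], h1.2⟩,
      abs_le.mpr ⟨by linarith [h2.1], h2.2⟩, abs_mul_abs_self (a 0), abs_mul_abs_self (a 1),
      abs_mul_abs_self (a 2), abs_mul (a 0) (a 1), abs_mul (a 0) (a 2), abs_mul (a 1) (a 2),
      le_abs_self (a 0 * a 1), le_abs_self (a 0 * a 2), le_abs_self (a 1 * a 2),
      abs_nonneg (a 0), abs_nonneg (a 1), abs_nonneg (a 2)]
  exact_mod_cast this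

/-- `fccPoint (2 • a) = 2 • fccPoint a`, so norms double. [folklore] -/
private theorem norm_fcc_two_smul (a : Fin 3 → ℤ) : ‖fccPoint (2 • a)‖ = 2 * ‖fccPoint a‖ := by
  rw [map_nsmul, ← Nat.cast_smul_eq_nsmul ℝ, norm_smul]; norm_num

/-- The finite-range potential has finitely supported lattice sums: conversion of the `tsum` over
non-zero labels to a finite sum over a cube. [folklore] -/
private theorem tsum_subtype_ne_zero_eq_sum {f : (Fin 3 → ℤ) → ℝ} {n : ℕ}
    (hf : ∀ a, a ∉ box n → f a = 0) :
    ∑' a : {a : Fin 3 → ℤ // a ≠ 0}, f a.1 = ∑ a ∈ (box n).filter (· ≠ 0), f a := by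
  classical
  rw [tsum_eq_sum (s := (box n).subtype (· ≠ 0))]
  · exact Finset.sum_subtype_eq_sum_filter f
  · rintro ⟨a, ha⟩ h
    apply hf
    intro h'
    exact h (Finset.mem_subtype.2 h')

/-- A function vanishing off a cube is summable over the non-zero labels. [folklore] -/
private theorem summable_subtype_ne_zero {f : (Fin 3 → ℤ) → ℝ} {n : ℕ}
    (hf : ∀ a, a ∉ box n → f a = 0) :
    Summable fun a : {a : Fin 3 → ℤ // a ≠ 0} => f a.1 := by
  classical
  refine summable_of_ne_finset_zero (s := (box n).subtype (· ≠ 0)) ?_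
  rintro ⟨a, ha⟩ h
  apply hf
  intro h'
  exact h (Finset.mem_subtype.2 h')

/-- The index set of the three-body lattice sum, cut to a cube. [folklore] -/
private def pairBox (n : ℕ) : Finset ((Fin 3 → ℤ) × (Fin 3 → ℤ)) :=
  ((box n) ×ˢ (box n)).filter fun p => p.1 ≠ 0 ∧ p.2 ≠ 0 ∧ p.1 ≠ p.2

/-- Conversion of the `tsum` over ordered pairs of distinct non-zero labels to a finite sum, for a function vanishing off a product of cubes. [folklore] -/
private theorem tsum_pairs_eq_sum {g : (Fin 3 → ℤ) × (Fin 3 → ℤ) → ℝ} {n : ℕ}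
    (hg : ∀ p, p ∉ (box n) ×ˢ (box n) → g p = 0) :
    ∑' p : {p : (Fin 3 → ℤ) × (Fin 3 → ℤ) // p.1 ≠ 0 ∧ p.2 ≠ 0 ∧ p.1 ≠ p.2}, g p.1 =
      ∑ p ∈ pairBox n, g p := by
  classical
  rw [tsum_eq_sum (s := ((box n) ×ˢ (box n)).subtype fun p => p.1 ≠ 0 ∧ p.2 ≠ 0 ∧ p.1 ≠ p.2)]
  · exact Finset.sum_subtype_eq_sum_filter g
  · rintro ⟨p, hp⟩ h
    apply hg
    intro h'
    exact h (Finset.mem_subtype.2 h')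

/-- `2 Qh a < (m+1)²` puts `a` in the cube of half-width `m`. [folklore] -/
private theorem mem_box_of_Qh_lt {a : Fin 3 → ℤ} {m : ℕ} (h : 2 * Qh a < ((m:ℤ) + 1) ^ 2) : a ∈ box m := by
  rw [mem_box]
  intro i
  have h1 : a i ^ 2 < ((m:ℤ) + 1) ^ 2 := (sq_le_two_Qh a i).trans_lt h
  obtain ⟨h2, h3⟩ := abs_lt_of_sq_lt_sq' h1 (by positivity)
  constructor <;> omega

/-- Cubes are monotone in the half-width. [folklore] -/
private theorem box_mono {m n : ℕ} (h : m ≤ n) : box m ⊆ box n := by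
  intro a ha
  rw [mem_box] at ha ⊢
  intro i
  have := ha i
  constructor <;> omega


/-! ### J. The example three-body potential -/

open Real (smoothTransition)

/-- Plateau: `= 1` near `1`, `= 0` off `(1-α, 1+α)`, values in `[0,1]`. [folklore] -/
private def Aw (α t : ℝ) : ℝ :=
  smoothTransition ((t - (1 - α)) / (α / 2)) * smoothTransition ((1 + α - t) / (α / 2))

/-- `= 1` for `t ≤ 1 - α`, `= 0` for `t ≥ 1 - α/2`. [folklore] -/
private def Uc (α t : ℝ) : ℝ := smoothTransition ((1 - α / 2 - t) / (α / 2))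

/-- `= 1` for `t ≤ 4/3`, `= 0` for `t ≥ 7/5`. [folklore] -/
private def Wc (t : ℝ) : ℝ := smoothTransition ((7 / 5 - t) * 15)

/-- The example three-body potential (a symmetric function of the three side lengths). [folklore] -/
def Psi (α : ℝ) (s : Fin 3 → ℝ) : ℝ :=
  -(Aw α (s 0) * Aw α (s 1) * Aw α (s 2)) +
    1 / α * ((1 - (1 - Uc α (s 0)) * (1 - Uc α (s 1)) * (1 - Uc α (s 2))) *
      (Wc (s 0) * Wc (s 1) * Wc (s 2)))

/-- `Aw ≥ 0`. [folklore] -/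
private theorem Aw_nonneg (t : ℝ) : 0 ≤ Aw α t :=
  mul_nonneg (smoothTransition.nonneg _) (smoothTransition.nonneg _)
/-- `Aw ≤ 1`. [folklore] -/
private theorem Aw_le_one (t : ℝ) : Aw α t ≤ 1 :=
  mul_le_one₀ (smoothTransition.le_one _) (smoothTransition.nonneg _) (smoothTransition.le_one _)
/-- `Aw α 1 = 1`. [folklore] -/
private theorem Aw_one (hα : 0 < α) : Aw α 1 = 1 := by
  unfold Aw
  rw [smoothTransition.one_of_one_le, smoothTransition.one_of_one_le, mul_one]
  · rw [le_div_iff₀ (by positivity)]; linarith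
  · rw [le_div_iff₀ (by positivity)]; linarith
/-- `Aw α t = 0` if `|t - 1| ≥ α`. [folklore] -/
private theorem Aw_eq_zero (hα : 0 < α) {t : ℝ} (ht : α ≤ |t - 1|) : Aw α t = 0 := by
  unfold Aw
  rcases le_or_gt t 1 with h | h
  · rw [abs_of_nonpos (by linarith)] at ht
    rw [smoothTransition.zero_of_nonpos, zero_mul]
    exact div_nonpos_of_nonpos_of_nonneg (by linarith) (by positivity)
  · rw [abs_of_pos (by linarith)] at ht
    rw [mul_comm, smoothTransition.zero_of_nonpos, zero_mul]
    exact div_nonpos_of_nonpos_of_nonneg (by linarith) (by positivity)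

/-- `Uc ≥ 0`. [folklore] -/
private theorem Uc_nonneg (t : ℝ) : 0 ≤ Uc α t := smoothTransition.nonneg _
/-- `Uc ≤ 1`. [folklore] -/
private theorem Uc_le_one (t : ℝ) : Uc α t ≤ 1 := smoothTransition.le_one _
/-- `Uc α t = 1` for `t ≤ 1 - α`. [folklore] -/
private theorem Uc_eq_one (hα : 0 < α) {t : ℝ} (ht : t ≤ 1 - α) : Uc α t = 1 := by
  unfold Uc
  apply smoothTransition.one_of_one_le
  rw [le_div_iff₀ (by positivity)]; linarith
/-- `Uc α t = 0` for `t ≥ 1 - α/2`. [folklore] -/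
private theorem Uc_eq_zero (hα : 0 < α) {t : ℝ} (ht : 1 - α / 2 ≤ t) : Uc α t = 0 := by
  unfold Uc
  apply smoothTransition.zero_of_nonpos
  exact div_nonpos_of_nonpos_of_nonneg (by linarith) (by positivity)

/-- `Wc ≥ 0`. [folklore] -/
private theorem Wc_nonneg (t : ℝ) : 0 ≤ Wc t := smoothTransition.nonneg _
/-- `Wc ≤ 1`. [folklore] -/
private theorem Wc_le_one (t : ℝ) : Wc t ≤ 1 := smoothTransition.le_one _
/-- `Wc t = 1` for `t < 4/3`. [folklore] -/
private theorem Wc_eq_one {t : ℝ} (ht : t < 4 / 3) : Wc t = 1 := by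
  unfold Wc
  apply smoothTransition.one_of_one_le
  linarith
/-- `Wc t = 0` for `t ≥ 7/5`. [folklore] -/
private theorem Wc_eq_zero {t : ℝ} (ht : 7 / 5 ≤ t) : Wc t = 0 := by
  unfold Wc
  apply smoothTransition.zero_of_nonpos
  nlinarith

/-- `Psi α` is `C¹` (indeed smooth) on all of `ℝ³`. [folklore] -/
private theorem contDiff_Psi : ContDiff ℝ 1 (Psi α) := by
  have hS := (smoothTransition.contDiff (n := 1))
  have hc : ∀ i : Fin 3, ContDiff ℝ 1 (fun s : Fin 3 → ℝ => s i) := fun i => contDiff_apply ℝ ℝ i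
  have hA : ∀ i : Fin 3, ContDiff ℝ 1 (fun s : Fin 3 → ℝ => Aw α (s i)) := fun i =>
    (hS.comp (((hc i).sub contDiff_const).div_const _)).mul
      (hS.comp ((contDiff_const.sub (hc i)).div_const _))
  have hU : ∀ i : Fin 3, ContDiff ℝ 1 (fun s : Fin 3 → ℝ => Uc α (s i)) := fun i =>
    hS.comp ((contDiff_const.sub (hc i)).div_const _)
  have hW : ∀ i : Fin 3, ContDiff ℝ 1 (fun s : Fin 3 → ℝ => Wc (s i)) := fun i =>
    hS.comp ((contDiff_const.sub (hc i)).mul contDiff_const)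
  unfold Psi
  exact (((hA 0).mul (hA 1)).mul (hA 2)).neg.add
    (contDiff_const.mul ((contDiff_const.sub (((contDiff_const.sub (hU 0)).mul
      (contDiff_const.sub (hU 1))).mul (contDiff_const.sub (hU 2)))).mul
      (((hW 0).mul (hW 1)).mul (hW 2))))

/-- The second summand of `Psi` is non-negative. [folklore] -/
private theorem Psi_aux_nonneg (hα : 0 < α) (s : Fin 3 → ℝ) :
    0 ≤ 1 / α * ((1 - (1 - Uc α (s 0)) * (1 - Uc α (s 1)) * (1 - Uc α (s 2))) *
      (Wc (s 0) * Wc (s 1) * Wc (s 2))) := by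
  have h01 : 0 ≤ (1 - Uc α (s 0)) * (1 - Uc α (s 1)) :=
    mul_nonneg (sub_nonneg.2 (Uc_le_one (s 0))) (sub_nonneg.2 (Uc_le_one (s 1)))
  have h01' : (1 - Uc α (s 0)) * (1 - Uc α (s 1)) ≤ 1 :=
    mul_le_one₀ (by linarith [Uc_nonneg (α := α) (s 0)]) (sub_nonneg.2 (Uc_le_one (s 1)))
      (by linarith [Uc_nonneg (α := α) (s 1)])
  have h1 : (1 - Uc α (s 0)) * (1 - Uc α (s 1)) * (1 - Uc α (s 2)) ≤ 1 :=
    mul_le_one₀ h01' (sub_nonneg.2 (Uc_le_one (s 2))) (by linarith [Uc_nonneg (α := α) (s 2)])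
  have h2 : 0 ≤ Wc (s 0) * Wc (s 1) * Wc (s 2) :=
    mul_nonneg (mul_nonneg (Wc_nonneg _) (Wc_nonneg _)) (Wc_nonneg _)
  have : 0 ≤ 1 / α := by positivity
  exact mul_nonneg this (mul_nonneg (by linarith) h2)

/-- `Psi ≥ -1`. [folklore] -/
private theorem Psi_ge_neg_one (hα : 0 < α) (s : Fin 3 → ℝ) : -1 ≤ Psi α s := by
  unfold Psi
  have h01 : Aw α (s 0) * Aw α (s 1) ≤ 1 := mul_le_one₀ (Aw_le_one _) (Aw_nonneg _) (Aw_le_one _)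
  have h1 : Aw α (s 0) * Aw α (s 1) * Aw α (s 2) ≤ 1 :=
    mul_le_one₀ h01 (Aw_nonneg _) (Aw_le_one _)
  linarith [Psi_aux_nonneg hα s]

/-- `Psi ≥ 0` as soon as one side is `α`-far from `1`. [folklore] -/
private theorem Psi_nonneg_of (hα : 0 < α) {s : Fin 3 → ℝ} (h : ∃ i, α ≤ |s i - 1|) : 0 ≤ Psi α s := by
  obtain ⟨i, hi⟩ := h
  have hA : Aw α (s 0) * Aw α (s 1) * Aw α (s 2) = 0 := by
    have h3 : ∀ j : Fin 3, j = 0 ∨ j = 1 ∨ j = 2 := by decide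
    rcases h3 i with rfl | rfl | rfl
    · rw [Aw_eq_zero hα hi]; ring
    · rw [Aw_eq_zero hα hi]; ring
    · rw [Aw_eq_zero hα hi]; ring
  unfold Psi
  rw [hA, neg_zero, zero_add]
  exact Psi_aux_nonneg hα s

/-- `Psi(1,1,1) = -1`. [folklore] -/
private theorem Psi_apply_one (hα : 0 < α) : Psi α (fun _ => 1) = -1 := by
  unfold Psi
  rw [Aw_one hα, Uc_eq_zero hα (by linarith)]
  ring

/-- `Psi = 1/α` on the core region (`minᵢ sᵢ ≤ 1-α`, `maxᵢ sᵢ < 4/3`). [folklore] -/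
private theorem Psi_core (hα : 0 < α) {s : Fin 3 → ℝ} (h1 : ∃ i, s i ≤ 1 - α) (h2 : ∀ i, s i < 4 / 3) :
    Psi α s = 1 / α := by
  obtain ⟨i, hi⟩ := h1
  have hiA : Aw α (s i) = 0 := Aw_eq_zero hα (by rw [abs_of_nonpos (by linarith)]; linarith)
  have hiU : Uc α (s i) = 1 := Uc_eq_one hα hi
  have hW : Wc (s 0) * Wc (s 1) * Wc (s 2) = 1 := by
    rw [Wc_eq_one (h2 0), Wc_eq_one (h2 1), Wc_eq_one (h2 2)]; ring
  unfold Psi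
  rw [hW]
  have h3 : ∀ j : Fin 3, j = 0 ∨ j = 1 ∨ j = 2 := by decide
  rcases h3 i with rfl | rfl | rfl
  · rw [hiA, hiU]; ring
  · rw [hiA, hiU]; ring
  · rw [hiA, hiU]; ring

/-- `Psi = 0` if some side is `≥ 7/5`. [folklore] -/
private theorem Psi_eq_zero_of (hα : 0 < α) (hα1 : α ≤ 1 / 400) {s : Fin 3 → ℝ} (h : ∃ i, 7 / 5 ≤ s i) :
    Psi α s = 0 := by
  obtain ⟨i, hi⟩ := h
  have hiA : Aw α (s i) = 0 := Aw_eq_zero hα (by rw [abs_of_pos (by linarith)]; linarith)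
  have hiW : Wc (s i) = 0 := Wc_eq_zero hi
  unfold Psi
  have h3 : ∀ j : Fin 3, j = 0 ∨ j = 1 ∨ j = 2 := by decide
  rcases h3 i with rfl | rfl | rfl
  · rw [hiA, hiW]; ring
  · rw [hiA, hiW]; ring
  · rw [hiA, hiW]; ring

/-- The example three-body potential is in the transcribed class (item 2 of Definition 2.1). [cite: FlatleyTheil2015, §2 Definition 2.1 (item 2), arXiv 1407.0692 p. 8 — membership in the class AS TRANSCRIBED] -/
theorem isLocalizedTriple_Psi (hα : 0 < α) (hα1 : α ≤ 1 / 400) : IsLocalizedTriple α (Psi α) where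
  contDiffOn := contDiff_Psi.contDiffOn
  apply_one := Psi_apply_one hα
  min := fun s _ => Psi_ge_neg_one hα s
  nonneg := fun _ _ h => Psi_nonneg_of hα h
  core := fun _ _ h1 h2 => (Psi_core hα h1 h2).ge
  eq_zero := fun _ _ h => Psi_eq_zero_of hα hα1 h

/-- `Psi` is a symmetric function of the side lengths, hence the three-body term is permutation
invariant. [folklore] -/
private theorem Psi_perm (y : Fin 3 → Space) (σ : Equiv.Perm (Fin 3)) :
    Psi α (sideLengths (y (σ 0)) (y (σ 1)) (y (σ 2))) = Psi α (sideLengths (y 0) (y 1) (y 2)) := by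
  have h3 : ∀ j : Fin 3, j = 0 ∨ j = 1 ∨ j = 2 := by decide
  have i01 : σ 0 ≠ σ 1 := fun h => absurd (σ.injective h) (by decide)
  have i12 : σ 1 ≠ σ 2 := fun h => absurd (σ.injective h) (by decide)
  have i02 : σ 0 ≠ σ 2 := fun h => absurd (σ.injective h) (by decide)
  have e10 := norm_sub_rev (y 1) (y 0)
  have e21 := norm_sub_rev (y 2) (y 1)
  have e20 := norm_sub_rev (y 2) (y 0)
  rcases h3 (σ 0) with h0 | h0 | h0 <;> rcases h3 (σ 1) with h1 | h1 | h1 <;>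
    rcases h3 (σ 2) with h2 | h2 | h2 <;>
    first
    | exact absurd (h0.trans h1.symm) i01
    | exact absurd (h1.trans h2.symm) i12
    | exact absurd (h0.trans h2.symm) i02
    | (rw [h0, h1, h2]
       try simp only [Psi, sideLengths, Matrix.cons_val_zero, Matrix.cons_val_one,
         Matrix.cons_val, e10, e21, e20]
       try ring)


/-! ### K. The lattice energies of the example -/

/-- Side lengths of the lattice triangle `(0, r k_a, r k_b)`. [folklore] -/
private def sides (r : ℝ) (a b : Fin 3 → ℤ) : Fin 3 → ℝ :=
  ![r * ‖fccPoint a‖, r * ‖fccPoint (b - a)‖, r * ‖fccPoint b‖]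

/-- The side lengths of a dilated lattice triangle. [folklore] -/
private theorem sideLengths_fcc {r : ℝ} (hr : 0 ≤ r) (a b : Fin 3 → ℤ) :
    sideLengths 0 (r • fccPoint a) (r • fccPoint b) = sides r a b := by
  ext i
  fin_cases i <;>
    simp [sideLengths, sides, norm_smul, abs_of_nonneg hr, ← smul_sub, map_sub, norm_sub_rev]

/-- Side lengths are non-negative. [folklore] -/
private theorem sides_nonneg {r : ℝ} (hr : 0 ≤ r) (a b : Fin 3 → ℤ) : ∀ i, 0 ≤ sides r a b i := by
  intro i
  fin_cases i
  · exact mul_nonneg hr (norm_nonneg _)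
  · exact mul_nonneg hr (norm_nonneg _)
  · exact mul_nonneg hr (norm_nonneg _)

/-- First side. [folklore] -/
@[simp] private theorem sides_zero (r : ℝ) (a b : Fin 3 → ℤ) : sides r a b 0 = r * ‖fccPoint a‖ := rfl
/-- Second side. [folklore] -/
@[simp] private theorem sides_one (r : ℝ) (a b : Fin 3 → ℤ) : sides r a b 1 = r * ‖fccPoint (b - a)‖ := rfl
/-- Third side. [folklore] -/
@[simp] private theorem sides_two (r : ℝ) (a b : Fin 3 → ℤ) : sides r a b 2 = r * ‖fccPoint b‖ := rfl

/-- Cube half-width containing every label that matters at dilation `r`. [folklore] -/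
private def nB (r : ℝ) : ℕ := ⌊6 / r⌋₊ + 1

/-- `6/r < nB r`. [folklore] -/
private theorem nB_spec (r : ℝ) : 6 / r < (nB r : ℝ) := by
  unfold nB; push_cast; exact Nat.lt_floor_add_one _

/-- `nB r ≥ 1`. [folklore] -/
private theorem one_le_nB (r : ℝ) : 1 ≤ nB r := by unfold nB; omega

/-- Labels of norm `≤ 3/r` are in the cube. [folklore] -/
private theorem mem_box_nB {r : ℝ} (hr : 0 < r) {a : Fin 3 → ℤ} (h : r * ‖fccPoint a‖ ≤ 3) :
    a ∈ box (nB r) := by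
  refine mem_box_of_norm_le (t := 3 / r) ?_ ?_
  · rw [le_div_iff₀ hr]; linarith
  · have := nB_spec r
    have : 2 * (3 / r) = 6 / r := by ring
    linarith

/-- Labels outside the cube contribute `0` to the pair sum. [folklore] -/
private theorem Vp_mul_norm_eq_zero {r : ℝ} (hα : 0 < α) (hα1 : α ≤ 1 / 400) (hr : 0 < r)
    {a : Fin 3 → ℤ} (ha : a ∉ box (nB r)) : Vp α (r * ‖fccPoint a‖) = 0 := by
  apply Vp_zero₄ hα hα1
  by_contra h
  exact ha (mem_box_nB hr (by push Not at h; linarith))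

open Classical in
/-- The non-zero labels in the cube. [folklore] -/
private def Bnz (r : ℝ) : Finset (Fin 3 → ℤ) := (box (nB r)).filter (· ≠ 0)

/-- The pair lattice sum of the example as a finite sum over the cube. [folklore] -/
private theorem fccLatticeSum_eq_sum (hα : 0 < α) (hα1 : α ≤ 1 / 400) {r : ℝ} (hr : 0 < r) :
    fccLatticeSum (Vp α) r = ∑ a ∈ Bnz r, Vp α (r * ‖fccPoint a‖) := by
  unfold fccLatticeSum Bnz
  exact tsum_subtype_ne_zero_eq_sum (f := fun a => Vp α (r * ‖fccPoint a‖))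
    (fun _ ha => Vp_mul_norm_eq_zero hα hα1 hr ha)

/-- Summability of the pair lattice sums of the example (finite support). [folklore] -/
private theorem summable_Vp (hα : 0 < α) (hα1 : α ≤ 1 / 400) {r : ℝ} (hr : 0 < r) :
    Summable fun a : {a : Fin 3 → ℤ // a ≠ 0} => Vp α (r * ‖fccPoint a.1‖) :=
  summable_subtype_ne_zero (f := fun a => Vp α (r * ‖fccPoint a‖))
    (fun _ ha => Vp_mul_norm_eq_zero hα hα1 hr ha)

/-- The three-body lattice sum as a finite sum over the cube (any `Ψ` of the class has finite range). [folklore] -/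
private theorem threeBody_eq_sum {Ψ : (Fin 3 → ℝ) → ℝ} (hΨ : IsLocalizedTriple α Ψ) {r : ℝ}
    (hr : 0 < r) :
    ∑' p : {p : (Fin 3 → ℤ) × (Fin 3 → ℤ) // p.1 ≠ 0 ∧ p.2 ≠ 0 ∧ p.1 ≠ p.2},
        Ψ (sideLengths 0 (r • fccPoint p.1.1) (r • fccPoint p.1.2)) =
      ∑ p ∈ pairBox (nB r), Ψ (sides r p.1 p.2) := by
  have h := tsum_pairs_eq_sum (n := nB r)
    (g := fun p => Ψ (sideLengths 0 (r • fccPoint p.1) (r • fccPoint p.2))) ?_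
  · rw [h]
    exact Finset.sum_congr rfl fun p _ => by rw [sideLengths_fcc hr.le]
  · intro p hp
    show Ψ (sideLengths 0 (r • fccPoint p.1) (r • fccPoint p.2)) = 0
    rw [sideLengths_fcc hr.le]
    rw [Finset.mem_product, not_and_or] at hp
    apply hΨ.eq_zero _ (sides_nonneg hr.le _ _)
    rcases hp with hp | hp
    · refine ⟨0, ?_⟩
      by_contra h
      exact hp (mem_box_nB hr (by simp at h ⊢; linarith))
    · refine ⟨2, ?_⟩
      by_contra h
      exact hp (mem_box_nB hr (by simp at h ⊢; linarith))

/-! #### Pointwise lower bounds -/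

/-- Pointwise lower bound for `V` by indicator functions of core, well, deep well and plateau. [folklore] -/
private theorem Vp_pointwise (hα : 0 < α) (hα1 : α ≤ 1 / 400) (x : ℝ) :
    (2 / α - 1) * (if x ≤ 1 - α then 1 else 0) - (if 1 - α < x ∧ x < 1 + α then 1 else 0)
      - 1000 * (if 267 / 200 < x ∧ x < 273 / 200 then 1 else 0)
      + 1000 * (if 213 / 80 ≤ x ∧ x ≤ 273 / 100 then 1 else 0) ≤ Vp α x := by
  by_cases h1 : x ≤ 1 - α
  · rw [if_pos h1, if_neg (by rintro ⟨h, _⟩; linarith), if_neg (by rintro ⟨h, _⟩; linarith),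
      if_neg (by rintro ⟨h, _⟩; linarith)]
    have := Vp_core hα hα1 h1
    linarith
  rw [if_neg h1]
  push Not at h1
  by_cases h2 : x < 1 + α
  · rw [if_pos ⟨h1, h2⟩, if_neg (by rintro ⟨h, _⟩; linarith), if_neg (by rintro ⟨h, _⟩; linarith)]
    have := Vp_well_ge hα hα1 ⟨h1.le, h2.le⟩
    linarith
  push Not at h2
  rw [if_neg (by rintro ⟨_, h⟩; linarith)]
  by_cases h3 : 267 / 200 < x ∧ x < 273 / 200
  · rw [if_pos h3, if_neg (by rintro ⟨h, _⟩; linarith [h3.2])]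
    have := Vp_ge hα hα1 x
    linarith
  rw [if_neg h3]
  by_cases h4 : 213 / 80 ≤ x ∧ x ≤ 273 / 100
  · rw [if_pos h4, Vp_plateau hα hα1 h4.1 h4.2]; linarith
  rw [if_neg h4]
  have : 0 ≤ Vp α x := Vp_nonneg_of hα hα1 (Or.inr h2) (by
    rcases not_and_or.1 h3 with h | h
    · exact Or.inl (not_lt.1 h)
    · exact Or.inr (not_lt.1 h))
  linarith

/-- A side outside `(1-α, 1+α)` is `α`-far from `1`. [folklore] -/
private theorem abs_ge_of_not_near (hα : 0 < α) {x : ℝ} (h : ¬(1 - α < x ∧ x < 1 + α)) :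
    α ≤ |x - 1| := by
  rcases not_and_or.1 h with h | h
  · have := not_lt.1 h; rw [abs_of_nonpos (by linarith)]; linarith
  · have := not_lt.1 h; rw [abs_of_nonneg (by linarith)]; linarith

/-- The "payment" condition (a `Ψ`-core triangle) and the "penalty" condition (possibly negative
`Ψ`) for a lattice triangle. [folklore] -/
private def PayP (α r : ℝ) (p : (Fin 3 → ℤ) × (Fin 3 → ℤ)) : Prop :=
  r * ‖fccPoint p.1‖ ≤ 1 - α ∧ r * ‖fccPoint (p.2 - p.1)‖ < 4 / 3 ∧ r * ‖fccPoint p.2‖ < 4 / 3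

/-- The label's dilated length lies in the well `(1-α, 1+α)`. [folklore] -/
private def NearP (α r : ℝ) (a : Fin 3 → ℤ) : Prop := 1 - α < r * ‖fccPoint a‖ ∧ r * ‖fccPoint a‖ < 1 + α

/-- Both outer sides of the lattice triangle lie in the well (only then can `Ψ` be negative). [folklore] -/
private def PenP (α r : ℝ) (p : (Fin 3 → ℤ) × (Fin 3 → ℤ)) : Prop := NearP α r p.1 ∧ NearP α r p.2

open Classical in
/-- Pointwise lower bound for `Ψ` on lattice triangles: `1/α` on payment triangles, `-1` on penalty triangles, `0` otherwise (uses only the class axioms). [folklore] -/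
private theorem Psi_pointwise {Ψ : (Fin 3 → ℝ) → ℝ} (hα : 0 < α) (hΨ : IsLocalizedTriple α Ψ) {r : ℝ}
    (hr : 0 ≤ r) (p : (Fin 3 → ℤ) × (Fin 3 → ℤ)) :
    1 / α * (if PayP α r p then 1 else 0) - (if PenP α r p then 1 else 0) ≤ Ψ (sides r p.1 p.2) := by
  by_cases hP : PayP α r p
  · rw [if_pos hP, if_neg (by rintro ⟨⟨h, _⟩, _⟩; exact absurd hP.1 (not_le.2 h))]
    have := hΨ.core (sides r p.1 p.2) (sides_nonneg hr _ _) ⟨0, hP.1⟩ (by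
      intro i; fin_cases i
      · show r * ‖fccPoint p.1‖ < 4 / 3; linarith [hP.1]
      · exact hP.2.1
      · exact hP.2.2)
    linarith
  rw [if_neg hP]
  by_cases hN : PenP α r p
  · rw [if_pos hN]; have := hΨ.min (sides r p.1 p.2) (sides_nonneg hr _ _); linarith
  rw [if_neg hN]
  have : 0 ≤ Ψ (sides r p.1 p.2) := by
    apply hΨ.nonneg _ (sides_nonneg hr _ _)
    rcases not_and_or.1 hN with h | h
    · exact ⟨0, abs_ge_of_not_near hα h⟩
    · exact ⟨2, abs_ge_of_not_near hα h⟩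
  linarith

/-! #### The finite index sets -/

open Classical in
/-- Labels in the core `r|k| ≤ 1-α`. [folklore] -/
private def coreF (α r : ℝ) : Finset (Fin 3 → ℤ) := (Bnz r).filter fun a => r * ‖fccPoint a‖ ≤ 1 - α
open Classical in
/-- Labels in the well. [folklore] -/
private def nearF (α r : ℝ) : Finset (Fin 3 → ℤ) := (Bnz r).filter fun a => NearP α r a
open Classical in
/-- Labels in the deep well `(1.335, 1.365)`. [folklore] -/
private def w2F (r : ℝ) : Finset (Fin 3 → ℤ) :=
  (Bnz r).filter fun a => 267 / 200 < r * ‖fccPoint a‖ ∧ r * ‖fccPoint a‖ < 273 / 200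
open Classical in
/-- Labels on the compensating plateau `[2.6625, 2.73]`. [folklore] -/
private def plF (r : ℝ) : Finset (Fin 3 → ℤ) :=
  (Bnz r).filter fun a => 213 / 80 ≤ r * ‖fccPoint a‖ ∧ r * ‖fccPoint a‖ ≤ 273 / 100
open Classical in
/-- Payment triangles. [folklore] -/
private def payF (α r : ℝ) : Finset ((Fin 3 → ℤ) × (Fin 3 → ℤ)) := (pairBox (nB r)).filter (PayP α r)
open Classical in
/-- Penalty triangles. [folklore] -/
private def penF (α r : ℝ) : Finset ((Fin 3 → ℤ) × (Fin 3 → ℤ)) := (pairBox (nB r)).filter (PenP α r)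

/-- Membership in `Bnz`. [folklore] -/
private theorem mem_Bnz {r : ℝ} {a : Fin 3 → ℤ} : a ∈ Bnz r ↔ a ∈ box (nB r) ∧ a ≠ 0 := by
  classical
  exact Finset.mem_filter

/-- Membership in `pairBox`. [folklore] -/
private theorem mem_pairBox {n : ℕ} {p : (Fin 3 → ℤ) × (Fin 3 → ℤ)} :
    p ∈ pairBox n ↔ (p.1 ∈ box n ∧ p.2 ∈ box n) ∧ p.1 ≠ 0 ∧ p.2 ≠ 0 ∧ p.1 ≠ p.2 := by
  classical
  rw [pairBox, Finset.mem_filter, Finset.mem_product]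

/-- Doubling a label, coordinatewise. [folklore] -/
private theorem two_smul_apply (a : Fin 3 → ℤ) (i : Fin 3) : (2 • a) i = 2 * a i := by
  simp [two_mul]

/-- Doubling labels is injective. [folklore] -/
private theorem two_smul_injective : Function.Injective fun a : Fin 3 → ℤ => 2 • a := by
  intro a b h
  funext i
  have := congr_fun h i
  simp only [two_smul_apply] at this
  omega

/-- Doubling a non-zero label gives a non-zero label. [folklore] -/
private theorem two_smul_ne_zero {a : Fin 3 → ℤ} (ha : a ≠ 0) : 2 • a ≠ 0 := by
  intro h; apply ha
  exact two_smul_injective (by simpa using h)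

open Classical in
/-- The pair sum dominates the indicator combination (summed pointwise bound). [folklore] -/
private theorem pairSum_ge_aux (hα : 0 < α) (hα1 : α ≤ 1 / 400) (r : ℝ) :
    (2 / α - 1) * (coreF α r).card - (nearF α r).card - 1000 * (w2F r).card + 1000 * (plF r).card
      ≤ ∑ a ∈ Bnz r, Vp α (r * ‖fccPoint a‖) := by
  have h := Finset.sum_le_sum fun a (_ : a ∈ Bnz r) => Vp_pointwise hα hα1 (r * ‖fccPoint a‖)
  simp only [Finset.sum_add_distrib, Finset.sum_sub_distrib, ← Finset.mul_sum, Finset.sum_boole]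
    at h
  simpa only [coreF, nearF, w2F, plF, NearP] using h

/-- Doubling maps deep-well labels injectively to plateau labels: the plateau pays for the deep well. [folklore] -/
private theorem card_w2F_le {r : ℝ} (hr : 0 < r) : (w2F r).card ≤ (plF r).card := by
  classical
  refine Finset.card_le_card_of_injOn (fun a => 2 • a) (fun a ha => ?_)
    (fun a _ b _ h => two_smul_injective h)
  rw [w2F, Finset.mem_coe, Finset.mem_filter, mem_Bnz] at ha
  obtain ⟨⟨_, ha0⟩, h1, h2⟩ := ha
  rw [plF, Finset.mem_coe, Finset.mem_filter, mem_Bnz, norm_fcc_two_smul]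
  refine ⟨⟨mem_box_nB hr ?_, two_smul_ne_zero ha0⟩, ?_, ?_⟩
  · rw [norm_fcc_two_smul]; nlinarith
  · nlinarith
  · nlinarith

/-- General lower bound for the pair lattice sum. [folklore] -/
private theorem pairSum_ge (hα : 0 < α) (hα1 : α ≤ 1 / 400) {r : ℝ} (hr : 0 < r) :
    (2 / α - 1) * (coreF α r).card - (nearF α r).card ≤ ∑ a ∈ Bnz r, Vp α (r * ‖fccPoint a‖) := by
  have h1 := pairSum_ge_aux hα hα1 r
  have h2 : ((w2F r).card : ℝ) ≤ (plF r).card := by exact_mod_cast card_w2F_le hr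
  linarith

open Classical in
/-- General lower bound for the three-body lattice sum. [folklore] -/
private theorem tripleSum_ge {Ψ : (Fin 3 → ℝ) → ℝ} (hα : 0 < α) (hΨ : IsLocalizedTriple α Ψ) {r : ℝ}
    (hr : 0 < r) :
    1 / α * (payF α r).card - (penF α r).card ≤ ∑ p ∈ pairBox (nB r), Ψ (sides r p.1 p.2) := by
  have h := Finset.sum_le_sum fun p (_ : p ∈ pairBox (nB r)) => Psi_pointwise hα hΨ hr.le p
  simp only [Finset.sum_sub_distrib, ← Finset.mul_sum, Finset.sum_boole] at h
  simpa only [payF, penF] using h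

/-! #### The unit vectors -/

open Classical in
/-- The labels of the nearest neighbours of the origin. [folklore] -/
private def U : Finset (Fin 3 → ℤ) := (box 1).filter fun a => Qh a = 1

/-- `#U ≤ 27` (crude: `U ⊂ [-1,1]³`). [folklore] -/
private theorem card_U_le : U.card ≤ 27 := by
  classical
  exact (Finset.card_filter_le _ _).trans (by rw [card_box]; norm_num)

/-- Labels with `Qh = 1` have length `1`. [folklore] -/
private theorem norm_eq_one_of_Qh {a : Fin 3 → ℤ} (h : Qh a = 1) : ‖fccPoint a‖ = 1 := by
  rw [norm_fcc, h]; simp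

/-- Labels with `Qh = 1` are non-zero. [folklore] -/
private theorem ne_zero_of_Qh {a : Fin 3 → ℤ} (h : Qh a = 1) : a ≠ 0 := by
  intro ha; rw [(Qh_eq_zero_iff a).2 ha] at h; exact zero_ne_one h

/-- All other non-zero labels have length `≥ 7/5` (indeed `≥ √2`). [folklore] -/
private theorem sqrt_two_le_norm_of_Qh_ne {a : Fin 3 → ℤ} (ha : a ≠ 0) (h : Qh a ≠ 1) :
    (7 / 5 : ℝ) ≤ ‖fccPoint a‖ := by
  have h2 : 2 ≤ Qh a := by have := one_le_Qh ha; omega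
  have h2' : (2:ℝ) ≤ Qh a := by exact_mod_cast h2
  rw [norm_fcc]
  exact le_sqrt_of_sq_le (by norm_num) (by linarith)

open Classical in
/-- The unit labels of any of the cubes are exactly `U`. [folklore] -/
private theorem filter_Qh_eq_U {r : ℝ} : (Bnz r).filter (fun a => Qh a = 1) = U := by
  ext a
  rw [Finset.mem_filter, mem_Bnz, U, Finset.mem_filter]
  constructor
  · rintro ⟨⟨_, _⟩, h⟩
    exact ⟨mem_box_of_Qh_lt (by rw [h]; norm_num), h⟩
  · rintro ⟨h1, h⟩
    exact ⟨⟨box_mono (one_le_nB r) h1, ne_zero_of_Qh h⟩, h⟩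

/-! #### Regime II: `1 - α < r < 1 + α` -/

open Classical in
/-- Regime II (`r > 1-α`): only nearest neighbours can be negative, `pair ≥ #U · V(r)`. [folklore] -/
private theorem pairSum_ge_II (hα : 0 < α) (hα1 : α ≤ 1 / 400) {r : ℝ} (hr1 : 1 - α < r) :
    U.card * Vp α r ≤ ∑ a ∈ Bnz r, Vp α (r * ‖fccPoint a‖) := by
  have h := Finset.sum_le_sum fun a (ha : a ∈ Bnz r) =>
    (show (if Qh a = 1 then Vp α r else 0) ≤ Vp α (r * ‖fccPoint a‖) from by
      split_ifs with h
      · rw [norm_eq_one_of_Qh h, mul_one]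
      · have h75 := sqrt_two_le_norm_of_Qh_ne (mem_Bnz.1 ha).2 h
        have : (273 / 200 : ℝ) ≤ r * ‖fccPoint a‖ := by nlinarith
        exact Vp_nonneg_past hα hα1 (by norm_num [ℓ]; nlinarith) (Or.inr this))
  rw [← Finset.sum_filter, Finset.sum_const, filter_Qh_eq_U, nsmul_eq_mul] at h
  exact h

open Classical in
/-- Regime II: only triangles of nearest neighbours can be negative, `three-body ≥ -#U²`. [folklore] -/
private theorem tripleSum_ge_II {Ψ : (Fin 3 → ℝ) → ℝ} (hα : 0 < α) (hα1 : α ≤ 1 / 400)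
    (hΨ : IsLocalizedTriple α Ψ) {r : ℝ} (hr1 : 1 - α < r) :
    -((U.card : ℝ) * U.card) ≤ ∑ p ∈ pairBox (nB r), Ψ (sides r p.1 p.2) := by
  have hr : 0 < r := by linarith
  have key : ∀ a : Fin 3 → ℤ, a ≠ 0 → Qh a ≠ 1 → α ≤ |r * ‖fccPoint a‖ - 1| := by
    intro a ha h
    have h75 := sqrt_two_le_norm_of_Qh_ne ha h
    rw [abs_of_nonneg (by nlinarith)]; nlinarith
  have h := Finset.sum_le_sum fun p (hp : p ∈ pairBox (nB r)) =>
    (show -(if Qh p.1 = 1 ∧ Qh p.2 = 1 then (1:ℝ) else 0) ≤ Ψ (sides r p.1 p.2) from by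
      rw [mem_pairBox] at hp
      split_ifs with h
      · exact hΨ.min _ (sides_nonneg hr.le _ _)
      · rw [neg_zero]
        apply hΨ.nonneg _ (sides_nonneg hr.le _ _)
        rcases not_and_or.1 h with h | h
        · exact ⟨0, key _ hp.2.1 h⟩
        · exact ⟨2, key _ hp.2.2.1 h⟩)
  rw [Finset.sum_neg_distrib, Finset.sum_boole] at h
  refine le_trans (neg_le_neg ?_) h
  have hsub : (pairBox (nB r)).filter (fun p => Qh p.1 = 1 ∧ Qh p.2 = 1) ⊆ U ×ˢ U := by
    intro p hp
    rw [Finset.mem_filter, mem_pairBox] at hp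
    rw [Finset.mem_product, ← filter_Qh_eq_U (r := r), Finset.mem_filter, Finset.mem_filter,
      mem_Bnz, mem_Bnz]
    exact ⟨⟨⟨hp.1.1.1, hp.1.2.1⟩, hp.2.1⟩, ⟨⟨hp.1.1.2, hp.1.2.2.1⟩, hp.2.2⟩⟩
  have := Finset.card_le_card hsub
  rw [Finset.card_product] at this
  exact_mod_cast this

/-! #### Regime I: `r ≥ 1 + α` -/

/-- No core labels for `r > 1-α`. [folklore] -/
private theorem coreF_eq_empty {r : ℝ} (hr0 : 0 < r) (hr : 1 - α < r) : coreF α r = ∅ := by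
  classical
  rw [coreF, Finset.filter_eq_empty_iff]
  intro a ha h
  have h1 := one_le_norm_fcc (mem_Bnz.1 ha).2
  nlinarith [mul_le_mul_of_nonneg_left h1 hr0.le]

/-- No well labels for `r ≥ 1+α`. [folklore] -/
private theorem nearF_eq_empty {r : ℝ} (hr : 1 + α ≤ r) : nearF α r = ∅ := by
  classical
  rw [nearF, Finset.filter_eq_empty_iff]
  intro a ha h
  have h1 := one_le_norm_fcc (mem_Bnz.1 ha).2
  have : 0 ≤ 1 + α := by linarith [h.1, h.2]
  nlinarith [h.2]

/-- No penalty triangles for `r ≥ 1+α`. [folklore] -/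
private theorem penF_eq_empty {r : ℝ} (hr : 1 + α ≤ r) : penF α r = ∅ := by
  classical
  rw [penF, Finset.filter_eq_empty_iff]
  intro p hp h
  have h1 := one_le_norm_fcc (mem_pairBox.1 hp).2.1
  have h2 := h.1
  have : 0 ≤ 1 + α := by linarith [h2.1, h2.2]
  nlinarith [h2.2]

/-- Regime I (`r ≥ 1+α`): the pair sum is `≥ 0`. [folklore] -/
private theorem pairSum_ge_I (hα : 0 < α) (hα1 : α ≤ 1 / 400) {r : ℝ} (hr : 1 + α ≤ r) :
    0 ≤ ∑ a ∈ Bnz r, Vp α (r * ‖fccPoint a‖) := by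
  have h := pairSum_ge hα hα1 (r := r) (by linarith)
  rw [coreF_eq_empty (by linarith) (by linarith), nearF_eq_empty hr] at h
  simpa using h

/-- Regime I: the three-body sum is `≥ 0`. [folklore] -/
private theorem tripleSum_ge_I {Ψ : (Fin 3 → ℝ) → ℝ} (hα : 0 < α) (hΨ : IsLocalizedTriple α Ψ) {r : ℝ}
    (hr : 1 + α ≤ r) : 0 ≤ ∑ p ∈ pairBox (nB r), Ψ (sides r p.1 p.2) := by
  have h := tripleSum_ge hα hΨ (r := r) (by linarith)
  rw [penF_eq_empty hr, Finset.card_empty, Nat.cast_zero, sub_zero] at h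
  have : 0 ≤ 1 / α * ((payF α r).card : ℝ) := by positivity
  linarith

/-! #### Regime III: `r ≤ 1 - α` -/

/-- Well labels lie in a cube of half-width `⌊2(1+α)/r⌋`. [folklore] -/
private theorem nearF_subset_box {r : ℝ} (hr : 0 < r) : nearF α r ⊆ box ⌊2 * (1 + α) / r⌋₊ := by
  classical
  intro a ha
  rw [nearF, Finset.mem_filter] at ha
  obtain ⟨_, _, h2⟩ := ha
  refine mem_box_of_norm_le (t := (1 + α) / r) ?_ ?_
  · rw [le_div_iff₀ hr]; linarith
  · have := Nat.lt_floor_add_one (2 * (1 + α) / r)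
    have e : 2 * ((1 + α) / r) = 2 * (1 + α) / r := by ring
    rw [e]; exact this

/-- At most `(4(1+α)/r + 1)³` well labels. [folklore] -/
private theorem card_nearF_le (hα : 0 < α) {r : ℝ} (hr : 0 < r) :
    ((nearF α r).card : ℝ) ≤ (4 * (1 + α) / r + 1) ^ 3 := by
  have h1 := Finset.card_le_card (nearF_subset_box (α := α) hr)
  rw [card_box] at h1
  have h2 : ((nearF α r).card : ℝ) ≤ ((2 * ⌊2 * (1 + α) / r⌋₊ + 1) ^ 3 : ℕ) := by
    exact_mod_cast h1
  have h3 : (⌊2 * (1 + α) / r⌋₊ : ℝ) ≤ 2 * (1 + α) / r := Nat.floor_le (by positivity)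
  have h3' : (2:ℝ) * (2 * (1 + α) / r) = 4 * (1 + α) / r := by ring
  have h4 : (((2 * ⌊2 * (1 + α) / r⌋₊ + 1) ^ 3 : ℕ) : ℝ) ≤ (4 * (1 + α) / r + 1) ^ 3 := by
    push_cast
    exact pow_le_pow_left₀ (by positivity) (by linarith) 3
  exact h2.trans h4

/-- Penalty triangles have both labels in the well. [folklore] -/
private theorem penF_subset (α r : ℝ) : penF α r ⊆ nearF α r ×ˢ nearF α r := by
  classical
  intro p hp
  rw [penF, Finset.mem_filter, mem_pairBox] at hp
  rw [Finset.mem_product, nearF, Finset.mem_filter, Finset.mem_filter, mem_Bnz, mem_Bnz]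
  exact ⟨⟨⟨hp.1.1.1, hp.1.2.1⟩, hp.2.1⟩, ⟨⟨hp.1.1.2, hp.1.2.2.1⟩, hp.2.2⟩⟩

/-- At most `#near²` penalty triangles. [folklore] -/
private theorem card_penF_le (α r : ℝ) :
    ((penF α r).card : ℝ) ≤ (nearF α r).card * (nearF α r).card := by
  have := Finset.card_le_card (penF_subset α r)
  rw [Finset.card_product] at this
  exact_mod_cast this

/-- Two neighbouring nearest-neighbour labels. [folklore] -/
private def e1 : Fin 3 → ℤ := ![1, 0, 0]
/-- A second nearest-neighbour label, at distance `1` from `e1`. [folklore] -/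
private def e2 : Fin 3 → ℤ := ![0, 1, 0]

/-- `|e1| = 1`. [folklore] -/
private theorem Qh_e1 : Qh e1 = 1 := by simp [Qh, e1]
/-- `|e2| = 1`. [folklore] -/
private theorem Qh_e2 : Qh e2 = 1 := by simp [Qh, e2]
/-- `|e2 - e1| = 1`. [folklore] -/
private theorem Qh_e2_sub_e1 : Qh (e2 - e1) = 1 := by simp [Qh, e1, e2]
/-- `e1 ≠ e2`. [folklore] -/
private theorem e1_ne_e2 : e1 ≠ e2 := by
  intro h; have := congr_fun h 0; simp [e1, e2] at this

/-- In regime III the label `e1` is a core label. [folklore] -/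
private theorem e1_mem_coreF (hα : 0 < α) {r : ℝ} (hr : 0 < r) (hr1 : r ≤ 1 - α) :
    e1 ∈ coreF α r := by
  classical
  rw [coreF, Finset.mem_filter, mem_Bnz, norm_eq_one_of_Qh Qh_e1, mul_one]
  exact ⟨⟨mem_box_nB hr (by rw [norm_eq_one_of_Qh Qh_e1]; linarith), ne_zero_of_Qh Qh_e1⟩, hr1⟩

/-- Regime III: at least one core label. [folklore] -/
private theorem one_le_card_coreF (hα : 0 < α) {r : ℝ} (hr : 0 < r) (hr1 : r ≤ 1 - α) :
    (1:ℝ) ≤ (coreF α r).card := by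
  have : 0 < (coreF α r).card := Finset.card_pos.2 ⟨e1, e1_mem_coreF hα hr hr1⟩
  exact_mod_cast this

/-- In regime III `(e1, e2)` is a payment triangle. [folklore] -/
private theorem pair_mem_payF (hα : 0 < α) {r : ℝ} (hr : 0 < r) (hr1 : r ≤ 1 - α) :
    (e1, e2) ∈ payF α r := by
  classical
  rw [payF, Finset.mem_filter, mem_pairBox, PayP]
  simp only
  rw [norm_eq_one_of_Qh Qh_e1, norm_eq_one_of_Qh Qh_e2, norm_eq_one_of_Qh Qh_e2_sub_e1, mul_one]
  have hb : ∀ a : Fin 3 → ℤ, Qh a = 1 → a ∈ box (nB r) := fun a ha =>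
    mem_box_nB hr (by rw [norm_eq_one_of_Qh ha]; linarith)
  exact ⟨⟨⟨hb _ Qh_e1, hb _ Qh_e2⟩, ne_zero_of_Qh Qh_e1, ne_zero_of_Qh Qh_e2, e1_ne_e2⟩, hr1,
    by linarith, by linarith⟩

/-- Regime III: at least one payment triangle. [folklore] -/
private theorem one_le_card_payF (hα : 0 < α) {r : ℝ} (hr : 0 < r) (hr1 : r ≤ 1 - α) :
    (1:ℝ) ≤ (payF α r).card := by
  have : 0 < (payF α r).card := Finset.card_pos.2 ⟨_, pair_mem_payF hα hr hr1⟩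
  exact_mod_cast this

/-- Labels in the cube of half-width `⌊1/(5r)⌋` have `r |k| ≤ 1/2`. [folklore] -/
private theorem r_norm_le_half {r : ℝ} (hr : 0 < r) {a : Fin 3 → ℤ} (ha : a ∈ box ⌊1 / (5 * r)⌋₊) :
    r * ‖fccPoint a‖ ≤ 1 / 2 := by
  have hsq := normSq_le_of_mem_box ha
  set mR : ℝ := ((⌊1 / (5 * r)⌋₊ : ℕ) : ℝ)
  have hm : mR ≤ 1 / (5 * r) := Nat.floor_le (by positivity)
  have hrm : r * mR ≤ 1 / 5 := by
    have := mul_le_mul_of_nonneg_left hm hr.le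
    rwa [show r * (1 / (5 * r)) = 1 / 5 by field_simp] at this
  have hrm0 : 0 ≤ r * mR := by positivity
  have hA : r ^ 2 * ‖fccPoint a‖ ^ 2 ≤ r ^ 2 * (6 * mR ^ 2) :=
    mul_le_mul_of_nonneg_left hsq (sq_nonneg r)
  have hB : (r * mR) ^ 2 ≤ (1 / 5) ^ 2 := pow_le_pow_left₀ hrm0 hrm 2
  have h1 : (r * ‖fccPoint a‖) ^ 2 ≤ 6 / 25 := by nlinarith
  have h0 : 0 ≤ r * ‖fccPoint a‖ := by positivity
  nlinarith

/-- The non-zero labels of the cube of half-width `⌊1/(5r)⌋` are core labels. [folklore] -/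
private theorem box_erase_subset_coreF (hα1 : α ≤ 1 / 400) {r : ℝ} (hr : 0 < r) :
    (box ⌊1 / (5 * r)⌋₊).erase 0 ⊆ coreF α r := by
  classical
  intro a ha
  rw [Finset.mem_erase] at ha
  have h := r_norm_le_half hr ha.2
  rw [coreF, Finset.mem_filter, mem_Bnz]
  exact ⟨⟨mem_box_nB hr (by linarith), ha.1⟩, by linarith⟩

/-- The punctured cube has `(2m+1)³ - 1` points. [folklore] -/
private theorem card_box_erase (m : ℕ) : (((box m).erase 0).card : ℝ) = (2 * m + 1 : ℝ) ^ 3 - 1 := by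
  have h := Finset.card_erase_add_one (zero_mem_box m)
  rw [card_box] at h
  have : (((box m).erase 0).card : ℝ) + 1 = ((2 * m + 1) ^ 3 : ℕ) := by exact_mod_cast h
  push_cast at this; linarith

/-- Ordered pairs of distinct non-zero labels of the cube of half-width `⌊1/(5r)⌋` are payment triangles. [folklore] -/
private theorem offDiag_subset_payF (hα1 : α ≤ 1 / 400) {r : ℝ} (hr : 0 < r) :
    ((box ⌊1 / (5 * r)⌋₊).erase 0).offDiag ⊆ payF α r := by
  classical
  intro p hp
  rw [Finset.mem_offDiag] at hp
  obtain ⟨h1, h2, h12⟩ := hp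
  rw [Finset.mem_erase] at h1 h2
  have b1 := r_norm_le_half hr h1.2
  have b2 := r_norm_le_half hr h2.2
  have b3 : r * ‖fccPoint (p.2 - p.1)‖ ≤ 1 := by
    rw [map_sub]
    have := norm_sub_le (fccPoint p.2) (fccPoint p.1)
    nlinarith
  rw [payF, Finset.mem_filter, mem_pairBox, PayP]
  exact ⟨⟨⟨mem_box_nB hr (by linarith), mem_box_nB hr (by linarith)⟩, h1.1, h2.1, h12⟩,
    by linarith, by linarith, by linarith⟩

/-- Regime III (`r ≤ 1-α`): core repulsion dominates, the pair sum is `≥ 0` (split at `r = 1/10`; uses `α ≤ 10⁻¹⁰`). [folklore] -/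
private theorem pairSum_ge_III (hα : 0 < α) (hα2 : α ≤ 1 / 10 ^ 10) {r : ℝ} (hr : 0 < r)
    (hr1 : r ≤ 1 - α) : 0 ≤ ∑ a ∈ Bnz r, Vp α (r * ‖fccPoint a‖) := by
  have hα1 : α ≤ 1 / 400 := hα2.trans (by norm_num)
  have h := pairSum_ge hα hα1 hr
  have hNn := card_nearF_le hα hr
  have h2a : (2:ℝ) * 10 ^ 10 ≤ 2 / α := by
    rw [le_div_iff₀ hα]; nlinarith
  have hc0 : 0 ≤ 2 / α - 1 := by linarith
  set T := 1 / r with hT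
  have hT0 : 0 < T := by positivity
  have hX : 4 * (1 + α) / r + 1 = 4 * (1 + α) * T + 1 := by rw [hT]; ring
  rw [hX] at hNn
  rcases le_or_gt (1 / 10) r with hr10 | hr10
  · -- `T ≤ 10`
    have hT10 : T ≤ 10 := by rw [hT, div_le_iff₀ hr]; linarith
    have hαT : α * T ≤ 1 / 400 * 10 := mul_le_mul hα1 hT10 hT0.le (by norm_num)
    have hB : 4 * (1 + α) * T + 1 ≤ 411 / 10 := by linarith
    have hB3 : (4 * (1 + α) * T + 1) ^ 3 ≤ (411 / 10) ^ 3 :=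
      pow_le_pow_left₀ (by positivity) hB 3
    have hC := one_le_card_coreF hα hr hr1
    have h3 : (2 / α - 1) * 1 ≤ (2 / α - 1) * (coreF α r).card := mul_le_mul_of_nonneg_left hC hc0
    norm_num at hB3
    linarith
  · -- `T > 10`
    have hT10 : 10 < T := by rw [hT, lt_div_iff₀ hr]; linarith
    have hT3 : 1000 ≤ T ^ 3 := by
      have := pow_le_pow_left₀ (by norm_num) hT10.le 3; norm_num at this; linarith
    set mR : ℝ := ((⌊1 / (5 * r)⌋₊ : ℕ) : ℝ) with hmR
    have hm : T / 5 - 1 < mR := by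
      have h1 : 1 / (5 * r) < mR + 1 := Nat.lt_floor_add_one _
      rw [show 1 / (5 * r) = T / 5 by rw [hT]; field_simp] at h1
      linarith
    have hY : 3 / 10 * T ≤ 2 * mR + 1 := by linarith
    have hY3 : (3 / 10 * T) ^ 3 ≤ (2 * mR + 1) ^ 3 := pow_le_pow_left₀ (by positivity) hY 3
    rw [show (3 / 10 * T) ^ 3 = 27 / 1000 * T ^ 3 by ring] at hY3
    have hN : 26 / 1000 * T ^ 3 ≤ (2 * mR + 1) ^ 3 - 1 := by linarith
    have hcore : (2 * mR + 1) ^ 3 - 1 ≤ ((coreF α r).card : ℝ) := by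
      have := Finset.card_le_card (box_erase_subset_coreF hα1 hr)
      have h' : (((box ⌊1 / (5 * r)⌋₊).erase 0).card : ℝ) ≤ (coreF α r).card := by
        exact_mod_cast this
      rwa [card_box_erase] at h'
    have hαT : α * T ≤ 1 / 400 * T := mul_le_mul_of_nonneg_right hα1 hT0.le
    have hB : 4 * (1 + α) * T + 1 ≤ 411 / 100 * T := by linarith
    have hB3 : (4 * (1 + α) * T + 1) ^ 3 ≤ (411 / 100 * T) ^ 3 :=
      pow_le_pow_left₀ (by positivity) hB 3
    rw [show (411 / 100 * T) ^ 3 = (411 / 100) ^ 3 * T ^ 3 by ring] at hB3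
    have h3 : (2 / α - 1) * (26 / 1000 * T ^ 3) ≤ (2 / α - 1) * (coreF α r).card :=
      mul_le_mul_of_nonneg_left (hN.trans hcore) hc0
    have h5 : 2 * 10 ^ 10 * T ^ 3 ≤ 2 / α * T ^ 3 :=
      mul_le_mul_of_nonneg_right h2a (by positivity)
    have e : (2 / α - 1) * (26 / 1000 * T ^ 3) = 26 / 1000 * (2 / α * T ^ 3) - 26 / 1000 * T ^ 3 := by
      ring
    rw [e] at h3
    norm_num at hB3 h5
    linarith

/-- Regime III: the `Ψ`-core dominates, the three-body sum is `≥ 0` (split at `r = 1/10`; uses `α ≤ 10⁻¹⁰`). [folklore] -/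
private theorem tripleSum_ge_III {Ψ : (Fin 3 → ℝ) → ℝ} (hα : 0 < α) (hα2 : α ≤ 1 / 10 ^ 10)
    (hΨ : IsLocalizedTriple α Ψ) {r : ℝ} (hr : 0 < r) (hr1 : r ≤ 1 - α) :
    0 ≤ ∑ p ∈ pairBox (nB r), Ψ (sides r p.1 p.2) := by
  have hα1 : α ≤ 1 / 400 := hα2.trans (by norm_num)
  have h := tripleSum_ge hα hΨ hr
  have hNn := card_nearF_le hα hr
  have hQ := card_penF_le α r
  have hNn0 : (0:ℝ) ≤ (nearF α r).card := Nat.cast_nonneg _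
  have h1a : (10000000000:ℝ) ≤ 1 / α := by
    rw [le_div_iff₀ hα]; norm_num at hα2; nlinarith
  have hia : (0:ℝ) ≤ 1 / α := by positivity
  set T := 1 / r with hT
  have hT0 : 0 < T := by positivity
  have hX : 4 * (1 + α) / r + 1 = 4 * (1 + α) * T + 1 := by rw [hT]; ring
  rw [hX] at hNn
  set B := (4 * (1 + α) * T + 1) ^ 3 with hBdef
  have hB0 : 0 ≤ B := by positivity
  have hQ2 : ((penF α r).card : ℝ) ≤ B * B := hQ.trans (mul_le_mul hNn hNn hNn0 hB0)
  rcases le_or_gt (1 / 10) r with hr10 | hr10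
  · have hT10 : T ≤ 10 := by rw [hT, div_le_iff₀ hr]; linarith
    have hαT : α * T ≤ 1 / 400 * 10 := mul_le_mul hα1 hT10 hT0.le (by norm_num)
    have hb : 4 * (1 + α) * T + 1 ≤ 411 / 10 := by linarith
    have hB3 : B ≤ (411 / 10) ^ 3 := pow_le_pow_left₀ (by positivity) hb 3
    have hBB : B * B ≤ (411 / 10) ^ 3 * (411 / 10) ^ 3 := mul_le_mul hB3 hB3 hB0 (by positivity)
    have hBB' : B * B ≤ 4830000000 := hBB.trans (by norm_num)
    have hP := one_le_card_payF hα hr hr1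
    have h3 : 1 / α * 1 ≤ 1 / α * (payF α r).card := mul_le_mul_of_nonneg_left hP hia
    rw [mul_one] at h3
    linarith
  · have hT10 : 10 < T := by rw [hT, lt_div_iff₀ hr]; linarith
    have hT3 : 1000 ≤ T ^ 3 := by
      have := pow_le_pow_left₀ (by norm_num) hT10.le 3; norm_num at this; linarith
    set mR : ℝ := ((⌊1 / (5 * r)⌋₊ : ℕ) : ℝ) with hmR
    have hm : T / 5 - 1 < mR := by
      have h1 : 1 / (5 * r) < mR + 1 := Nat.lt_floor_add_one _
      rw [show 1 / (5 * r) = T / 5 by rw [hT]; field_simp] at h1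
      linarith
    have hY : 3 / 10 * T ≤ 2 * mR + 1 := by linarith
    have hY3 : (3 / 10 * T) ^ 3 ≤ (2 * mR + 1) ^ 3 := pow_le_pow_left₀ (by positivity) hY 3
    rw [show (3 / 10 * T) ^ 3 = 27 / 1000 * T ^ 3 by ring] at hY3
    set N0 : ℝ := (2 * mR + 1) ^ 3 - 1 with hN0
    have hN : 26 / 1000 * T ^ 3 ≤ N0 := by rw [hN0]; linarith
    have hpay : N0 * N0 - N0 ≤ ((payF α r).card : ℝ) := by
      have := Finset.card_le_card (offDiag_subset_payF hα1 hr)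
      rw [Finset.offDiag_card] at this
      set S := (box ⌊1 / (5 * r)⌋₊).erase 0 with hS
      have hS' : (S.card : ℝ) = N0 := by rw [hN0, hS, card_box_erase]
      have h' : ((S.card * S.card - S.card : ℕ) : ℝ) ≤ (payF α r).card := by exact_mod_cast this
      rw [Nat.cast_sub (Nat.le_mul_self _), Nat.cast_mul, hS'] at h'
      exact h'
    have hαT : α * T ≤ 1 / 400 * T := mul_le_mul_of_nonneg_right hα1 hT0.le
    have hb : 4 * (1 + α) * T + 1 ≤ 411 / 100 * T := by linarith
    have hB3 : B ≤ (411 / 100 * T) ^ 3 := pow_le_pow_left₀ (by positivity) hb 3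
    have hBB : B * B ≤ (411 / 100 * T) ^ 3 * (411 / 100 * T) ^ 3 :=
      mul_le_mul hB3 hB3 hB0 (by positivity)
    set X := T ^ 3 * T ^ 3 with hXdef
    have hX0 : 0 ≤ X := by positivity
    have hBB' : B * B ≤ 4821 * X := by
      rw [show (411 / 100 * T) ^ 3 * (411 / 100 * T) ^ 3 = (411 / 100) ^ 6 * X by rw [hXdef]; ring]
        at hBB
      exact hBB.trans (mul_le_mul_of_nonneg_right (by norm_num) hX0)
    -- payment ≥ a (a - 1) with a = 0.026 T³
    have hprod : 0 ≤ (N0 - 26 / 1000 * T ^ 3) * (N0 + 26 / 1000 * T ^ 3 - 1) :=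
      mul_nonneg (sub_nonneg.2 hN) (by linarith)
    have hT6 : 1000 * T ^ 3 ≤ X := by
      rw [hXdef]; exact mul_le_mul_of_nonneg_right hT3 (by positivity)
    have hP6 : 65 / 100000 * X ≤ ((payF α r).card : ℝ) := by
      have e : (N0 - 26 / 1000 * T ^ 3) * (N0 + 26 / 1000 * T ^ 3 - 1) =
          (N0 * N0 - N0) - (676 / 1000000 * X - 26 / 1000 * T ^ 3) := by rw [hXdef]; ring
      rw [e] at hprod
      linarith
    have h3 : 1 / α * (65 / 100000 * X) ≤ 1 / α * (payF α r).card :=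
      mul_le_mul_of_nonneg_left hP6 hia
    have h5 : 10000000000 * (65 / 100000 * X) ≤ 1 / α * (65 / 100000 * X) :=
      mul_le_mul_of_nonneg_right h1a (by positivity)
    linarith

/-! #### The pair energy at `r = 1` and the structure `IsLocalizedPair` -/

/-- `E_pair(1) = -#U`: at `r = 1` only the nearest neighbours contribute (`V(√q) = 0` for `q ≥ 2`). [folklore] -/
private theorem fccLatticeSum_one (hα : 0 < α) (hα1 : α ≤ 1 / 400) :
    fccLatticeSum (Vp α) 1 = -(U.card : ℝ) := by
  classical
  rw [fccLatticeSum_eq_sum hα hα1 one_pos]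
  have : ∀ a ∈ Bnz 1, Vp α (1 * ‖fccPoint a‖) = if Qh a = 1 then -1 else 0 := by
    intro a ha
    rw [one_mul]
    split_ifs with h
    · rw [norm_eq_one_of_Qh h, Vp_one]
    · have h2 : 2 ≤ Qh a := by have := one_le_Qh (mem_Bnz.1 ha).2; omega
      rw [norm_fcc]; exact Vp_sqrt_eq_zero hα hα1 h2
  rw [Finset.sum_congr rfl this, Finset.sum_ite, Finset.sum_const_zero, add_zero, Finset.sum_const,
    filter_Qh_eq_U, nsmul_eq_mul, mul_neg_one]

/-- No dilation lowers the pair energy: `E_pair(1) ≤ E_pair(r)` for all `r > 0`. [folklore] -/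
private theorem le_fccLatticeSum_Vp (hα : 0 < α) (hα2 : α ≤ 1 / 10 ^ 10) {r : ℝ} (hr : 0 < r) :
    fccLatticeSum (Vp α) 1 ≤ fccLatticeSum (Vp α) r := by
  have hα1 : α ≤ 1 / 400 := hα2.trans (by norm_num)
  have hU : (0:ℝ) ≤ U.card := Nat.cast_nonneg _
  rw [fccLatticeSum_one hα hα1, fccLatticeSum_eq_sum hα hα1 hr]
  rcases le_or_gt r (1 - α) with h1 | h1
  · linarith [pairSum_ge_III hα hα2 hr h1]
  rcases lt_or_ge r (1 + α) with h2 | h2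
  · have h := pairSum_ge_II hα hα1 h1
    have hV := Vp_well_ge hα hα1 ⟨h1.le, h2.le⟩
    nlinarith
  · linarith [pairSum_ge_I hα hα1 h2]

/-- The example pair potential is in the transcribed class. [cite: FlatleyTheil2015, §2 Definition 2.1 (item 1), arXiv 1407.0692 pp. 7–8 — membership in the class AS TRANSCRIBED] -/
theorem isLocalizedPair_Vp (hα : 0 < α) (hα2 : α ≤ 1 / 10 ^ 10) : IsLocalizedPair α (Vp α) :=
  have hα1 : α ≤ 1 / 400 := hα2.trans (by norm_num)
  { contDiffOn := contDiff_Vp.contDiffOn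
    tendsto_zero := tendsto_Vp hα hα1
    apply_one := Vp_one
    summable := fun _ hr => summable_Vp hα hα1 hr
    le_fccLatticeSum := fun _ hr => le_fccLatticeSum_Vp hα hα2 hr
    fcc_selection := Vp_fcc_selection hα hα1
    core := Vp_core_field hα hα1
    convex := Vp_convex_field hα hα1
    deriv_sqrt_three_nonneg := (Vp_deriv_sqrt_three hα hα1).ge
    medium := Vp_medium_field hα hα1
    decay := Vp_decay_field hα hα1 }

/-- `E_fcc(r) ≥ -756` for every dilation `r > 0`. [folklore] -/
private theorem fccEnergy_ge (hα : 0 < α) (hα2 : α ≤ 1 / 10 ^ 10) {r : ℝ} (hr : 0 < r) :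
    -756 ≤ fccEnergy (Vp α) (Psi α) r := by
  have hα1 : α ≤ 1 / 400 := hα2.trans (by norm_num)
  have hΨ := isLocalizedTriple_Psi hα hα1
  rw [fccEnergy, fccLatticeSum_eq_sum hα hα1 hr, threeBody_eq_sum hΨ hr]
  rcases le_or_gt r (1 - α) with h1 | h1
  · linarith [pairSum_ge_III hα hα2 hr h1, tripleSum_ge_III hα hα2 hΨ hr h1]
  rcases lt_or_ge r (1 + α) with h2 | h2
  · have hp := pairSum_ge_II hα hα1 h1
    have ht := tripleSum_ge_II hα hα1 hΨ h1
    have hV := Vp_well_ge hα hα1 ⟨h1.le, h2.le⟩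
    have hU : (U.card : ℝ) ≤ 27 := by exact_mod_cast card_U_le
    have hU0 : (0:ℝ) ≤ U.card := Nat.cast_nonneg _
    nlinarith
  · linarith [pairSum_ge_I hα hα1 h2, tripleSum_ge_I hα hΨ h2]

end TranscribedExample

open TranscribedExample

/-- The energy of a two-point configuration. [folklore] -/
private theorem configEnergy_pair (V : ℝ → ℝ) (Ψ : (Fin 3 → ℝ) → ℝ) {p : Space} (hp : p ≠ 0) :
    configEnergy V Ψ {0, p} = 2 * V ‖p‖ := by
  classical
  have h0p : (0 : Space) ≠ p := hp.symm
  have e1 : ({0, p} : Finset Space).erase 0 = {p} :=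
    Finset.erase_insert (by simpa using h0p)
  have e2 : ({0, p} : Finset Space).erase p = {0} := by
    rw [Finset.erase_insert_of_ne h0p, Finset.erase_singleton]; rfl
  unfold configEnergy
  rw [Finset.sum_pair h0p, Finset.sum_pair h0p, e1, e2]
  simp [Finset.erase_singleton]
  ring

/-- **The transcribed Theorem 1.1 is false.** With `V''` read as Lean's `deriv^[2] V` (junk value
`0` where `V'` is not differentiable), the class `IsLocalizedPair α` contains, for every small
`α > 0`, a potential `V` whose derivative is a combination of Cantor staircases: `V` satisfies all
the second-derivative constraints trivially (`deriv (deriv V) = 0` off the well) yet has a second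
well of depth `1000` at `r = 27/20` (compensated in the lattice sums by a plateau at `2 · 27/20`),
so two particles at distance `27/20` have energy per particle `-1000 < -756 ≤ inf_r E_fcc(r)`,
contradicting clause (i). The printed theorem (with genuine second derivatives) is not affected:
see `FlatleyTheil2015_thm11_printed`. [cite: FlatleyTheil2015, §1 Theorem 1.1 (arXiv 1407.0692 p. 4) with §2 Definition 2.1 (pp. 7–8) — refutation of the TRANSCRIPTION `FlatleyTheil2015_thm11`, not of the printed theorem] -/
theorem FlatleyTheil2015_thm11_false : ¬ FlatleyTheil2015_thm11 := by
  rintro ⟨α₀, hα₀, H⟩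
  obtain ⟨α, hα, hαα₀, hα2⟩ : ∃ α, 0 < α ∧ α < α₀ ∧ α ≤ 1 / 10 ^ 10 :=
    ⟨min (α₀ / 2) (1 / 10 ^ 10), lt_min (by linarith) (by norm_num),
      (min_le_left _ _).trans_lt (by linarith), min_le_right _ _⟩
  have hα1 : α ≤ 1 / 400 := hα2.trans (by norm_num)
  obtain ⟨h1, -⟩ := H α hα hαα₀ (Vp α) (Psi α) (isLocalizedPair_Vp hα hα2)
    (isLocalizedTriple_Psi hα hα1) (fun y σ => Psi_perm y σ)
  set p : Space := (27 / 20 : ℝ) • fccPoint ![1, 0, 0] with hp_def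
  have hnorm : ‖p‖ = 27 / 20 := by
    rw [hp_def, norm_smul, norm_fccPoint_single, Real.norm_eq_abs]; norm_num
  have hp : p ≠ 0 := by
    intro h; rw [h, norm_zero] at hnorm; norm_num at hnorm
  obtain ⟨r, hr, hlt⟩ := h1 {0, p} ⟨0, by simp⟩
  rw [configEnergy_pair _ _ hp, hnorm, Vp_wellCentre hα hα1, Finset.card_pair hp.symm] at hlt
  have := fccEnergy_ge hα hα2 hr
  norm_num at hlt
  linarith

end Literature.MathematicalPhysics.StatisticalMechanics.FlatleyTheil2015

end
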